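import Literature.NumberTheory.ConnesConsani2021.ProlateProjections
import Literature.Analysis.OperatorTheory.PairOfProjections
import Literature.Analysis.Fourier.FourierCompactSupportAnalytic
import Literature.Analysis.FunctionSpaces.FourierSobolevNormScalingProofs
import Literature.NumberTheory.ConnesConsani2021.SemilocalTwist
import HarnessLib

/-!
# Connes–Consani 2021, §4 (first part) — DISCHARGES of the named facts of `ProlateProjections.lean`

RH-FREE corpus literature (archimedean place only; nothing here bears on the truth of RH).  Cell
`rh-crit`, sub-cell `cc/`, seat t3, discharge pass (cc/ASSIGNMENTS §1.7: "`theorem <fact>_holds : <fact>`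
… in `…/<File>Proofs.lean`").  Theorems only (proof lane); the statement layer
`ProlateProjections.lean` is unchanged.

A. Connes, C. Consani, *Weil positivity and trace formula, the archimedean place*, Selecta Math. (N.S.)
27 (2021) 77 = arXiv:2006.13771 [bib: `ConnesConsani2021`], §4.

* `angleOp_spec`, `CC2021_lem_4_2_ii_holds` — Lemma 4.2 (ii) (= arXiv Lemma 22 (ii)): for orthogonal
  projections `P₁, P₂` the operator `α = arcsin|P₁ − P₂|` (Def. 4.3) is self-adjoint with spectrum in
  `[0, π/2]`, commutes with `P₁, P₂`, `sin α = |P₁ − P₂|`, `P₁P₂P₁ = cos²(α)P₁`, and is unique — by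
  Mathlib's continuous functional calculus (`cfc_comp'`, `cfc_map_spectrum`, `Commute.cfc_real`), the
  contraction estimate `‖P₁ − P₂‖ ≤ 1` and Kato's identities (`PairOfProjections`).
* `CC2021_rem_4_6_ii_holds` — Remark 4.6 (ii), eq. (sym1): `⟨ψ_n|ϑ(ρ⁻¹)ξ_n⟩ = ⟨ζ_n|ϑ(ρ⁻¹)ξ_n⟩ = 0` for
  `ρ ≥ 1` (disjoint supports up to the null set `{±1}`).
* `IsProlateFunction.integral_mul_eq_zero_of_ne` — Sturm–Liouville orthogonality of the tree prolate
  functions `h_{n,λ} ⊥ h_{m,λ}` (`n ≠ m`): Green's identity for the Wronskian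
  `W = (λ² − x²)(f′g − g′f)`, `W′ = (χ_g − χ_f)fg`, `W(±λ) = 0`, the eigenvalues being distinct by the
  tree's Cauchy uniqueness `IsProlateFunction.eq_mul_of_eigen_eq` and the zero counts.
* `inner_prolateXi`, `CC2021_sec4_xi_orthonormal_holds` — "the vectors `ξ_n` form an orthonormal basis of
  the range of `𝒫₁`" (p. 17), orthonormality half.
* `IsProlateFunction.integral_mul_cos_ode`, `IsProlateFunction.eq_mul_of_ode`,
  `IsProlateFunction.integral_mul_cos_eq_mul`, `CC2021_sec4_cosalphan_holds` — (prolateeq)/(cosalphan),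
  Slepian–Pollak's "commuting miracle" `∫_{−1}^{1} φ_n(x)e^{2πixω}dx = λ(n)φ_n(ω)` (`|ω| ≤ 1`), following
  the printed proof (Slepian–Pollak 1961 §III, Rokhlin–Xiao 2007 Thm. 4): the finite cosine transform
  of `h_{n,λ}` solves the prolate equation (differentiation under the integral sign + Green's identity
  for the kernel `cos(2πxω)`), and Cauchy uniqueness at the regular point `0`; general band `λ`.
* `prolateEtaFun_eq_of_mem`, `CC2021_prop_4_5_i_holds` — Prop. 4.5 (i), eq. (chirem0.5):
  `𝒫₁η_n = λ(n)ξ_n`; `prolatePsi_eq` (`ψ_n = η_n − λ(n)ξ_n`), `norm_prolatePsi`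
  (`‖ψ_n‖ = √(1−λ(n)²)`), `conj_prolatePsiFun` (`ψ_n` real valued), `inner_prolatePsi_eq_zero`
  (`ψ_n ⊥ ψ_m`) — three of the four clauses of Prop. 4.5 (iii); `abs_prolateEigen_lt_one`
  (`|λ(n)| < 1`, via the tree's "Fourier transform of a compactly supported function is entire",
  `FourierCompactSupportAnalytic`).
* `inner_prolateEta_lpDilation`, `prolateEta_eq_add`, `CC2021_prop_4_5_iv_holds` — Prop. 4.5 (iv),
  eq. (hattrick), following the printed proof: `η_n = λ(n)ξ_n + √(1−λ(n)²)ζ_n`,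
  `D_ρ ∘ 𝔽 = ρ⁻¹ 𝔽 ∘ D_{ρ⁻¹}` (tree `fourier_toLp_comp_smul`) and `ξ_n` real and even give
  `⟪η_n, D_ρ η_n⟫ = ⟪ξ_n, D_ρ ξ_n⟫`; expand and divide by `1 − λ(n)² > 0`.
* `fourier_prolateEta` (`𝔽η_n = ξ_n`, from `𝔽² =` reflection on `L²(ℝ)` by Schwartz density),
  `cutoffProjHat_prolateXi` (`𝒫̂₁ξ_n = λ(n)η_n`), `cutoffProjHat_prolateEta` (`𝒫̂₁η_n = η_n`),
  `cutoffProj_cutoffProjHat_prolateXi` ((cosalphan1) `𝒫₁𝒫̂₁𝒫₁ξ_n = λ(n)²ξ_n`),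
  `inner_outerProjHat_prolateXi` (the planes `E_n = span{ξ_n, η_n}` are pairwise orthogonal),
  `CC2021_prop_4_5_iii_holds` — Prop. 4.5 (iii) with (smaller) `Σ λ(n)²|ζ_n⟩⟨ζ_n| ≤ PP̂P` by Bessel's
  inequality for the orthonormal family `P̂ξ_n/√(1−λ(n)²)`, `⟨P̂ξ_n/√…, P̂Pξ⟩ = −λ(n)⟨ζ_n, ξ⟩`.
* `CC2021_lem_4_2_i_holds` — Lemma 4.2 (i): for an irreducible pair of orthogonal projections the angle
  operator is a scalar `α ∈ [0, π/2]` (`(P₁ − P₂)²` commutes with the pair, so the kernel of a bump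
  function of it reduces the pair; irreducibility makes its spectrum a point `{t}`, `α = arcsin √t`).
-/

noncomputable section

open _root_.MeasureTheory Complex Set FourierTransform Filter
open scoped Real ComplexConjugate InnerProductSpace ENNReal Topology

namespace Literature.NumberTheory.ConnesConsani2021

open Literature.NumberTheory.LFunctions Literature.Analysis.OperatorTheory

/-! ## Lemma 4.2 (ii): the angle operator (continuous functional calculus) -/

section Angle

variable {H : Type*} [NormedAddCommGroup H] [InnerProductSpace ℂ H] [CompleteSpace H]

/-- For an orthogonal projection `P`, `ran P ⊥ ran (1 − P)`: `⟪P y, z − P z⟫ = 0`. [folklore] -/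
private theorem starProj_inner_apply_sub_apply_eq_zero {P : H →L[ℂ] H} (hP : IsStarProjection P) (y z : H) :
    ⟪P y, z - P z⟫_ℂ = 0 := by
  have hadj : ContinuousLinearMap.adjoint P = P := hP.isSelfAdjoint.adjoint_eq
  have hPP : P (P z) = P z := by
    have := congrArg (fun T : H →L[ℂ] H => T z) hP.isIdempotentElem.eq
    simpa [mul_apply_eq_comp] using this
  rw [← ContinuousLinearMap.adjoint_inner_right, hadj, map_sub, hPP, sub_self, inner_zero_right]

/-- Pythagoras for an orthogonal projection: `‖x‖² = ‖Px‖² + ‖x − Px‖²`. [folklore] -/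
private theorem starProj_norm_sq_eq_add {P : H →L[ℂ] H} (hP : IsStarProjection P) (x : H) :
    ‖x‖ ^ 2 = ‖P x‖ ^ 2 + ‖x - P x‖ ^ 2 := by
  have h := @norm_add_sq ℂ H _ _ _ (P x) (x - P x)
  rw [add_sub_cancel, starProj_inner_apply_sub_apply_eq_zero hP x x] at h
  simpa using h

/-- `‖P₁x − P₂x‖ ≤ ‖x‖` for two orthogonal projections (`P₁x − P₂x = P₁(x − P₂x) − (1 − P₁)P₂x`, an
orthogonal sum). [folklore] -/
private theorem starProj_norm_sub_apply_le {P₁ P₂ : H →L[ℂ] H} (h₁ : IsStarProjection P₁) (h₂ : IsStarProjection P₂)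
    (x : H) : ‖P₁ x - P₂ x‖ ≤ ‖x‖ := by
  set u := P₁ (x - P₂ x) with hu
  set v := P₂ x - P₁ (P₂ x) with hv
  have hdec : P₁ x - P₂ x = u - v := by
    simp only [hu, hv, map_sub]; abel
  have horth : ⟪u, v⟫_ℂ = 0 := starProj_inner_apply_sub_apply_eq_zero h₁ _ _
  have hpy : ‖u - v‖ ^ 2 = ‖u‖ ^ 2 + ‖v‖ ^ 2 := by
    have h := @norm_sub_sq ℂ H _ _ _ u v
    rw [horth] at h
    simpa using h
  have hu' : ‖u‖ ^ 2 ≤ ‖x - P₂ x‖ ^ 2 := by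
    have := starProj_norm_sq_eq_add h₁ (x - P₂ x)
    nlinarith [sq_nonneg ‖(x - P₂ x) - P₁ (x - P₂ x)‖]
  have hv' : ‖v‖ ^ 2 ≤ ‖P₂ x‖ ^ 2 := by
    have := starProj_norm_sq_eq_add h₁ (P₂ x)
    nlinarith [sq_nonneg ‖P₁ (P₂ x)‖]
  have hx : ‖x‖ ^ 2 = ‖P₂ x‖ ^ 2 + ‖x - P₂ x‖ ^ 2 := starProj_norm_sq_eq_add h₂ x
  have hsq : ‖P₁ x - P₂ x‖ ^ 2 ≤ ‖x‖ ^ 2 := by rw [hdec, hpy]; linarith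
  exact (pow_le_pow_iff_left₀ (norm_nonneg _) (norm_nonneg _) two_ne_zero).mp hsq

/-- `‖P₁ − P₂‖ ≤ 1` for two orthogonal projections (so `|P₁ − P₂|`, `sin α` are contractions).
[cite: ConnesConsani2021, Lemma 4.2 (ii) §4 p. 15 (arXiv item Lemma 22, p0015:L63–L66)] -/
theorem starProj_norm_sub_le_one {P₁ P₂ : H →L[ℂ] H} (h₁ : IsStarProjection P₁) (h₂ : IsStarProjection P₂) :
    ‖P₁ - P₂‖ ≤ 1 :=
  ContinuousLinearMap.opNorm_le_bound _ zero_le_one fun x => by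
    rw [one_mul, sub_apply]; exact starProj_norm_sub_apply_le h₁ h₂ x

/-- The (real) spectrum of `P₁ − P₂` lies in `[−1, 1]`. [cite: ConnesConsani2021, Lemma 4.2 (ii) §4 p. 15 (arXiv item Lemma 22, p0015:L63–L66)] -/
theorem starProj_spectrum_sub_subset {P₁ P₂ : H →L[ℂ] H} (h₁ : IsStarProjection P₁) (h₂ : IsStarProjection P₂) :
    spectrum ℝ (P₁ - P₂) ⊆ Icc (-1) 1 := by
  intro x hx
  have h := spectrum.subset_closedBall_norm_mul (P₁ - P₂) hx
  rw [Metric.mem_closedBall, dist_zero_right, Real.norm_eq_abs] at h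
  have h1 : ‖(1 : H →L[ℂ] H)‖ ≤ 1 := ContinuousLinearMap.norm_id_le
  have hle : |x| ≤ 1 := by
    have := starProj_norm_sub_le_one h₁ h₂
    nlinarith [norm_nonneg (P₁ - P₂), norm_nonneg (1 : H →L[ℂ] H), abs_nonneg x]
  exact abs_le.mp hle

/-- **Lemma 4.2 (ii) for the explicit angle operator `α = arcsin|P₁ − P₂|`** (all clauses of
`CC2021_lem_4_2_ii`, for one Hilbert space): self-adjoint, spectrum in `[0, π/2]`, commutes with `P₁, P₂`
(`α` is a continuous function of `(P₁ − P₂)²`, which commutes with both, Kato I-(4.33) =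
`PairOfProjections.commute_left_sq_sub`), `sin α = |P₁ − P₂|` (spectral mapping, `|P₁ − P₂| ≤ 1`),
`P₁P₂P₁ = cos²(α)P₁` (`cos²(arcsin|x|) = 1 − x²` and `(1 − (P₁ − P₂)²)P₁ = P₁P₂P₁`), uniqueness
(`β = arcsin(sin β)` for `spec β ⊆ [0, π/2]`).  Continuous functional calculus throughout.  PROVED.
[cite: ConnesConsani2021, Lemma 4.2 (ii) §4 p. 15 (arXiv item Lemma 22, p0015:L63–L70); ConnesMarcolli2008, Ch. 2 §3.3 Lemma 2.3] -/
theorem angleOp_spec (P₁ P₂ : H →L[ℂ] H) (h₁ : IsStarProjection P₁) (h₂ : IsStarProjection P₂) :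
    IsSelfAdjoint (angleOp P₁ P₂) ∧ spectrum ℝ (angleOp P₁ P₂) ⊆ Icc 0 (π / 2) ∧
      Commute (angleOp P₁ P₂) P₁ ∧ Commute (angleOp P₁ P₂) P₂ ∧
      cfc Real.sin (angleOp P₁ P₂) = absDiff P₁ P₂ ∧
      P₁ * P₂ * P₁ = cfc Real.cos (angleOp P₁ P₂) ^ 2 * P₁ ∧
      (∀ β : H →L[ℂ] H, IsSelfAdjoint β → spectrum ℝ β ⊆ Icc 0 (π / 2) →
        cfc Real.sin β = absDiff P₁ P₂ → β = angleOp P₁ P₂) := by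
  set a : H →L[ℂ] H := P₁ - P₂ with ha_def
  have ha : IsSelfAdjoint a := h₁.isSelfAdjoint.sub h₂.isSelfAdjoint
  have hsp : spectrum ℝ a ⊆ Icc (-1) 1 := starProj_spectrum_sub_subset h₁ h₂
  have hg : Continuous fun x : ℝ => Real.arcsin |x| := Real.continuous_arcsin.comp continuous_abs
  have hP1 : P₁ * P₁ = P₁ := h₁.isIdempotentElem.eq
  have hP2 : P₂ * P₂ = P₂ := h₂.isIdempotentElem.eq
  -- (1) self-adjoint
  have hsa : IsSelfAdjoint (angleOp P₁ P₂) := cfc_predicate _ _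
  -- (2) spectrum
  have hspec : spectrum ℝ (angleOp P₁ P₂) ⊆ Icc 0 (π / 2) := by
    rw [angleOp, ← ha_def, cfc_map_spectrum (fun x : ℝ => Real.arcsin |x|) a ha hg.continuousOn]
    rintro _ ⟨x, -, rfl⟩
    exact ⟨Real.arcsin_nonneg.2 (abs_nonneg x), Real.arcsin_le_pi_div_two _⟩
  -- (3) commutation: α = G(a²)
  have hG : Continuous fun y : ℝ => Real.arcsin (Real.sqrt y) := Real.continuous_arcsin.comp Real.continuous_sqrt
  have hαsq : angleOp P₁ P₂ = cfc (fun y : ℝ => Real.arcsin (Real.sqrt y)) (a ^ 2) := by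
    rw [angleOp, ← ha_def, ← cfc_comp_pow (fun y : ℝ => Real.arcsin (Real.sqrt y)) 2 a hG.continuousOn ha]
    congr 1
    funext x
    rw [Real.sqrt_sq_eq_abs]
  have hc1 : Commute (angleOp P₁ P₂) P₁ := by
    rw [hαsq]
    refine Commute.cfc_real ?_ _
    rw [sq]
    exact (PairOfProjections.commute_left_sq_sub hP1 hP2).symm
  have hc2 : Commute (angleOp P₁ P₂) P₂ := by
    rw [hαsq]
    refine Commute.cfc_real ?_ _
    rw [sq]
    exact (PairOfProjections.commute_right_sq_sub hP1 hP2).symm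
  -- (4) sin α = |a|
  have hsin : cfc Real.sin (angleOp P₁ P₂) = absDiff P₁ P₂ := by
    rw [angleOp, absDiff, ← ha_def,
      ← cfc_comp' Real.sin (fun x : ℝ => Real.arcsin |x|) a Real.continuous_sin.continuousOn
        hg.continuousOn ha]
    refine cfc_congr fun x hx => ?_
    have hx' := hsp hx
    rw [Real.sin_arcsin (by linarith [abs_nonneg x, hx'.1]) (abs_le.2 ⟨by linarith [hx'.1], hx'.2⟩)]
  -- (5) P₁ P₂ P₁ = cos² α P₁
  have hcos : cfc Real.cos (angleOp P₁ P₂) ^ 2 = 1 - a ^ 2 := by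
    rw [angleOp, ← ha_def,
      ← cfc_comp' Real.cos (fun x : ℝ => Real.arcsin |x|) a Real.continuous_cos.continuousOn
        hg.continuousOn ha,
      ← cfc_pow (fun x : ℝ => Real.cos (Real.arcsin |x|)) 2 a
        ((Real.continuous_cos.comp hg).continuousOn) ha]
    have heq : (spectrum ℝ a).EqOn (fun x : ℝ => Real.cos (Real.arcsin |x|) ^ 2) (fun x => 1 - x ^ 2) := by
      intro x hx
      have hx' := hsp hx
      have habs : |x| ≤ 1 := abs_le.2 ⟨by linarith [hx'.1], hx'.2⟩
      simp only
      rw [Real.cos_arcsin, Real.sq_sqrt (by nlinarith [abs_nonneg x]), sq_abs]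
    rw [cfc_congr heq, cfc_sub _ _ a (continuousOn_const) ((continuous_pow 2).continuousOn),
      cfc_const_one ℝ a ha, cfc_pow_id a 2 ha]
  have hppp : P₁ * P₂ * P₁ = cfc Real.cos (angleOp P₁ P₂) ^ 2 * P₁ := by
    rw [hcos, sq, ha_def, PairOfProjections.sq_sub_eq hP1 hP2]
    have h3 : P₂ * P₁ * P₁ = P₂ * P₁ := by rw [mul_assoc, hP1]
    simp only [sub_mul, add_mul, one_mul, hP1, h3, mul_assoc]
    abel
  -- (6) uniqueness
  have huniq : ∀ β : H →L[ℂ] H, IsSelfAdjoint β → spectrum ℝ β ⊆ Icc 0 (π / 2) →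
      cfc Real.sin β = absDiff P₁ P₂ → β = angleOp P₁ P₂ := by
    intro β hβ hβsp hβsin
    have step1 : β = cfc (fun y : ℝ => Real.arcsin (Real.sin y)) β := by
      conv_lhs => rw [← cfc_id' ℝ β hβ]
      refine cfc_congr fun y hy => ?_
      have hy' := hβsp hy
      rw [Real.arcsin_sin (by linarith [hy'.1, Real.pi_pos]) hy'.2]
    rw [step1, cfc_comp' Real.arcsin Real.sin β Real.continuous_arcsin.continuousOn
      Real.continuous_sin.continuousOn hβ, hβsin, absDiff, angleOp, ← ha_def,
      ← cfc_comp' Real.arcsin (fun x : ℝ => |x|) a Real.continuous_arcsin.continuousOn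
        continuous_abs.continuousOn ha]
  exact ⟨hsa, hspec, hc1, hc2, hsin, hppp, huniq⟩

end Angle

/-- **Lemma 4.2 (ii), PROVED** (`CC2021_lem_4_2_ii` discharged: every Hilbert space, every pair of
orthogonal projections).  Net debt −1. [cite: ConnesConsani2021, Lemma 4.2 (ii) §4 p. 15 (arXiv item Lemma 22, p0015:L63–L70)] -/
theorem CC2021_lem_4_2_ii_holds : CC2021_lem_4_2_ii := by
  intro H _ _ _ P₁ P₂ h₁ h₂
  exact angleOp_spec P₁ P₂ h₁ h₂

/-! ## Remark 4.6 (ii) and the orthonormality of the `ξ_n` -/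

section Discharges

/-- **Remark 4.6 (ii), eq. (sym1), PROVED**: for `ρ ≥ 1`, `⟨ψ_n|ϑ(ρ⁻¹)ξ_n⟩ = 0 = ⟨ζ_n|ϑ(ρ⁻¹)ξ_n⟩` — the
supports of `ψ_n` (`|x| ≥ 1`) and of `x ↦ ξ_n(ρx)` (`|x| ≤ ρ⁻¹`) meet in the null set `{±1}` at most
("since `ξ_n(ρx) = 0` for `|x| > 1`").  Net debt −1.
[cite: ConnesConsani2021, Remark 4.6 (ii) §4 p. 18 eq. (sym1) (arXiv item Remark 26, p0018:L17–L24)] -/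
theorem CC2021_rem_4_6_ii_holds : CC2021_rem_4_6_ii := by
  intro n ρ hρ
  have hρ0 : 0 < ρ := one_pos.trans_le hρ
  have hnull : ∀ᵐ x : ℝ ∂(volume : Measure ℝ), x ∉ ({-1, 1} : Set ℝ) :=
    compl_mem_ae_iff.mpr ((Set.toFinite _).measure_zero volume)
  have key : ∀ x : ℝ, x ∉ ({-1, 1} : Set ℝ) →
      conj (prolatePsiFun n x) * (((Real.sqrt ρ : ℝ) : ℂ) * prolateXiFun n (ρ * x)) = 0 := by
    intro x hx
    simp only [mem_insert_iff, mem_singleton_iff, not_or] at hx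
    by_cases h1 : 1 ≤ |x|
    · have hne : |x| ≠ 1 := by
        intro h
        rcases (abs_eq zero_le_one).mp h with h' | h'
        · exact hx.2 h'
        · exact hx.1 h'
      have hgt : 1 < |x| := lt_of_le_of_ne h1 (Ne.symm hne)
      have hρx : 1 < |ρ * x| := by
        rw [abs_mul, abs_of_pos hρ0]
        exact one_lt_mul_of_le_of_lt hρ hgt
      simp [prolateXiFun, prolateFun_eq_zero hρx]
    · simp [prolatePsiFun, cutoffP, h1]
  constructor
  · rw [repCoeff_eq hρ0]
    exact integral_eq_zero_of_ae (by filter_upwards [hnull] with x hx using key x hx)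
  · rw [repCoeff_eq hρ0]
    refine integral_eq_zero_of_ae ?_
    filter_upwards [hnull] with x hx
    simp only [prolateZetaFun, map_mul, Pi.zero_apply]
    rw [mul_assoc, key x hx, mul_zero]

/-- **Sturm–Liouville orthogonality** (input of "the vectors `ξ_n` form an orthonormal basis of the range
of `𝒫₁`", p. 17): two tree prolate functions `h_{n,λ}`, `h_{m,λ}` with `n ≠ m` are orthogonal on
`[−λ, λ]`.  Green's identity for the Wronskian `W = (λ² − x²)(f′g − g′f)`, `W′ = (χ_g − χ_f) f g`,
`W(±λ) = 0`; distinct zero counts force distinct eigenvalues by the tree's Cauchy uniqueness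
`IsProlateFunction.eq_mul_of_eigen_eq`.  PROVED. [cite: ConnesConsani2021, Prop. 4.5 proof §4 p. 17 (arXiv p0017:L2); RokhlinXiao2007, Thm. 3 p. 109] -/
theorem _root_.Literature.NumberTheory.LFunctions.IsProlateFunction.integral_mul_eq_zero_of_ne
    {lam : ℝ} {n m : ℕ} {f g : ℝ → ℝ} (hf : IsProlateFunction lam n f) (hg : IsProlateFunction lam m g)
    (hnm : n ≠ m) : ∫ x in (-lam)..lam, f x * g x = 0 := by
  obtain ⟨χf, hχf⟩ := hf.eigen
  obtain ⟨χg, hχg⟩ := hg.eigen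
  have hlam := hf.lam_pos
  -- distinct zero counts ⇒ distinct eigenvalues
  have hne : χf ≠ χg := by
    intro heq
    subst heq
    have hprop := hf.eq_mul_of_eigen_eq hg hχf hχg
    have hc : f 0 / g 0 ≠ 0 := (div_pos hf.pos_zero hg.pos_zero).ne'
    have hZ : {x | x ∈ Ioo (-lam) lam ∧ f x = 0} = {x | x ∈ Ioo (-lam) lam ∧ g x = 0} := by
      ext x
      simp only [mem_setOf_eq, hprop x, mul_eq_zero, hc, false_or]
    have h1 := hf.zeros_card
    rw [hZ, hg.zeros_card] at h1
    exact hnm h1.symm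
  -- the Wronskian
  set f₁ := derivWithin f (Icc (-lam) lam) with hf₁
  set g₁ := derivWithin g (Icc (-lam) lam) with hg₁
  set W : ℝ → ℝ := fun x ↦ (lam ^ 2 - x ^ 2) * f₁ x * g x - (lam ^ 2 - x ^ 2) * g₁ x * f x with hW
  have hp : Continuous fun x : ℝ ↦ lam ^ 2 - x ^ 2 := by fun_prop
  have hWcont : ContinuousOn W (Icc (-lam) lam) :=
    ((hp.continuousOn.mul hf.continuousOn_derivWithin).mul hg.contDiffOn.continuousOn).sub
      ((hp.continuousOn.mul hg.continuousOn_derivWithin).mul hf.contDiffOn.continuousOn)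
  have hWderiv : ∀ x ∈ Ioo (-lam) lam, HasDerivAt W ((χg - χf) * (f x * g x)) x := by
    intro x hx
    have hF := hf.hasDerivAt_flux hχf hx
    have hG := hg.hasDerivAt_flux hχg hx
    have hf' := hf.hasDerivAt_derivWithin hx
    have hg' := hg.hasDerivAt_derivWithin hx
    have h := (hF.mul hg').sub (hG.mul hf')
    have hfun : W = (fun y ↦ (lam ^ 2 - y ^ 2) * derivWithin f (Icc (-lam) lam) y) *
        g - (fun y ↦ (lam ^ 2 - y ^ 2) * derivWithin g (Icc (-lam) lam) y) * f := by
      funext y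
      simp only [hW, hf₁, hg₁, Pi.sub_apply, Pi.mul_apply]
    rw [hfun]
    exact h.congr_deriv (by ring)
  have hWa : W (-lam) = 0 := by simp [hW]
  have hWb : W lam = 0 := by simp [hW]
  have hcont : ContinuousOn (fun x ↦ (χg - χf) * (f x * g x)) (uIcc (-lam) lam) := by
    rw [uIcc_of_le (by linarith)]
    exact continuousOn_const.mul (hf.contDiffOn.continuousOn.mul hg.contDiffOn.continuousOn)
  have hFTC := intervalIntegral.integral_eq_sub_of_hasDerivAt_of_le (by linarith) hWcont hWderiv
    hcont.intervalIntegrable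
  rw [hWb, hWa, sub_zero, intervalIntegral.integral_const_mul] at hFTC
  exact (mul_eq_zero.mp hFTC).resolve_left (sub_ne_zero.mpr (Ne.symm hne))

/-- `⟪ξ_n, ξ_m⟫ = ∫_{−1}^{1} h_{2n,1} h_{2m,1}` (real integrand).  PROVED. [cite: ConnesConsani2021, Prop. 4.5 proof §4 p. 17 (arXiv p0017:L2)] -/
theorem inner_prolateXi (n m : ℕ) :
    ⟪prolateXi n, prolateXi m⟫_ℂ = ((∫ x in (-1 : ℝ)..1, prolateFun n x * prolateFun m x : ℝ) : ℂ) := by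
  rw [L2.inner_def]
  have h1 : ∫ x : ℝ, ⟪(prolateXi n : ℝ → ℂ) x, (prolateXi m : ℝ → ℂ) x⟫_ℂ =
      ∫ x : ℝ, ((prolateFun n x * prolateFun m x : ℝ) : ℂ) := by
    refine integral_congr_ae ?_
    filter_upwards [prolateXi_coeFn n, prolateXi_coeFn m] with x hx hy
    rw [hx, hy]
    simp only [prolateXiFun, RCLike.inner_apply, conj_ofReal]
    push_cast
    ring
  rw [h1, integral_complex_ofReal]
  congr 1
  have h2 : (fun x : ℝ => prolateFun n x * prolateFun m x) =
      (Icc (-1 : ℝ) 1).indicator fun x => prolateFun n x * prolateFun m x := by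
    funext x
    by_cases hx : x ∈ Icc (-1 : ℝ) 1
    · rw [indicator_of_mem hx]
    · rw [indicator_of_notMem hx, prolateFun_eq_zero_of_notMem hx]; simp
  conv_lhs => rw [h2]
  rw [integral_indicator measurableSet_Icc, integral_Icc_eq_integral_Ioc,
    ← intervalIntegral.integral_of_le (by norm_num : (-1 : ℝ) ≤ 1)]

/-- **"The vectors `ξ_n` form an orthonormal basis of the range of `𝒫₁`" — orthonormality, PROVED**
(`‖ξ_n‖ = 1` and Sturm–Liouville orthogonality).  Net debt −1.
[cite: ConnesConsani2021, Prop. 4.5 proof §4 p. 17 (arXiv p0017:L2); RokhlinXiao2007, Thm. 3 p. 109] -/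
theorem CC2021_sec4_xi_orthonormal_holds : CC2021_sec4_xi_orthonormal := by
  classical
  rw [CC2021_sec4_xi_orthonormal, orthonormal_iff_ite]
  intro n m
  rw [inner_prolateXi]
  split_ifs with h
  · subst h
    have h1 := (isProlateFunction_prolateFun n).norm_one
    simp_rw [sq] at h1
    rw [h1]; simp
  · rw [(isProlateFunction_prolateFun n).integral_mul_eq_zero_of_ne (isProlateFunction_prolateFun m) ?_]
    · simp
    · intro h2; exact h (by omega)

/-! ## (prolateeq)/(cosalphan): Slepian–Pollak's commuting miracle

The printed proof (Slepian–Pollak 1961 §III; Rokhlin–Xiao 2007 Thm. 4): the finite cosine transform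
`g(ω) = ∫_{−λ}^{λ} f(x) cos(2πxω) dx` of the principal solution `f = h_{n,λ}` of
`−((λ²−x²)f′)′ + (2πλx)² f = χ f` solves the SAME equation in `ω` (differentiate under the integral sign and
integrate Green's identity for the kernel `cos(2πxω)`, whose prolate operator in `x` equals its prolate
operator in `ω`), with `g′(0) = 0`; Cauchy uniqueness at the regular point `0` (the tree's argument in
`IsProlateFunction.eq_mul_of_eigen_eq`) gives `g = (g(0)/f(0)) f` on `[−λ, λ]`. -/

variable {lam : ℝ} {n : ℕ} {f : ℝ → ℝ}

/-- Differentiation under the integral sign: `d/dω ∫_{−λ}^{λ} φ(x) cos(2πxω) dx = ∫ φ(x)(−2πx) sin(2πxω) dx`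
for `φ` continuous on `[−λ, λ]`. [folklore] -/
private theorem hasDerivAt_integral_mul_cos {φ : ℝ → ℝ} {lam : ℝ} (hlam : 0 < lam)
    (hφ : ContinuousOn φ (Icc (-lam) lam)) (ω₀ : ℝ) :
    HasDerivAt (fun ω ↦ ∫ x in (-lam)..lam, φ x * Real.cos (2 * π * x * ω))
      (∫ x in (-lam)..lam, φ x * (-(2 * π * x) * Real.sin (2 * π * x * ω₀))) ω₀ := by
  have hle : -lam ≤ lam := by linarith
  have hIoc : uIoc (-lam) lam ⊆ Icc (-lam) lam := by
    rw [uIoc_of_le hle]; exact Ioc_subset_Icc_self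
  have hcontF : ∀ ω : ℝ, ContinuousOn (fun x ↦ φ x * Real.cos (2 * π * x * ω)) (Icc (-lam) lam) :=
    fun ω ↦ hφ.mul (by fun_prop)
  have hcontF' : ∀ ω : ℝ,
      ContinuousOn (fun x ↦ φ x * (-(2 * π * x) * Real.sin (2 * π * x * ω))) (Icc (-lam) lam) :=
    fun ω ↦ hφ.mul (by fun_prop)
  have key := intervalIntegral.hasDerivAt_integral_of_dominated_loc_of_deriv_le
    (μ := (volume : Measure ℝ)) (a := -lam) (b := lam) (x₀ := ω₀) (s := univ)
    (F := fun ω x ↦ φ x * Real.cos (2 * π * x * ω))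
    (F' := fun ω x ↦ φ x * (-(2 * π * x) * Real.sin (2 * π * x * ω)))
    (bound := fun x ↦ |φ x| * (2 * π * lam)) univ_mem
    (Eventually.of_forall fun ω ↦
      ((hcontF ω).mono hIoc).aestronglyMeasurable measurableSet_uIoc)
    ((hcontF ω₀).intervalIntegrable_of_Icc hle)
    (((hcontF' ω₀).mono hIoc).aestronglyMeasurable measurableSet_uIoc)
    (Eventually.of_forall fun x hx ω _ ↦ by
      have hx' : x ∈ Icc (-lam) lam := hIoc hx
      rw [Real.norm_eq_abs, abs_mul, abs_mul, abs_neg]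
      refine mul_le_mul_of_nonneg_left ?_ (abs_nonneg _)
      have h1 : |2 * π * x| ≤ 2 * π * lam := by
        rw [abs_mul, abs_of_pos (by positivity : (0 : ℝ) < 2 * π)]
        exact mul_le_mul_of_nonneg_left (abs_le.2 ⟨by linarith [hx'.1], hx'.2⟩) (by positivity)
      have h2 : |Real.sin (2 * π * x * ω)| ≤ 1 := Real.abs_sin_le_one _
      nlinarith [abs_nonneg (2 * π * x), abs_nonneg (Real.sin (2 * π * x * ω))])
    (((hφ.abs).mul continuousOn_const).intervalIntegrable_of_Icc hle)
    (Eventually.of_forall fun x _ ω _ ↦ by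
      have h := (((hasDerivAt_id ω).const_mul (2 * π * x)).cos).const_mul (φ x)
      refine h.congr_deriv ?_
      simp only [id, mul_one]
      ring)
  exact key.2

/-- Differentiation under the integral sign: `d/dω ∫_{−λ}^{λ} φ(x) sin(2πxω) dx = ∫ φ(x)(2πx) cos(2πxω) dx`
for `φ` continuous on `[−λ, λ]`. [folklore] -/
private theorem hasDerivAt_integral_mul_sin {φ : ℝ → ℝ} {lam : ℝ} (hlam : 0 < lam)
    (hφ : ContinuousOn φ (Icc (-lam) lam)) (ω₀ : ℝ) :
    HasDerivAt (fun ω ↦ ∫ x in (-lam)..lam, φ x * Real.sin (2 * π * x * ω))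
      (∫ x in (-lam)..lam, φ x * ((2 * π * x) * Real.cos (2 * π * x * ω₀))) ω₀ := by
  have hle : -lam ≤ lam := by linarith
  have hIoc : uIoc (-lam) lam ⊆ Icc (-lam) lam := by
    rw [uIoc_of_le hle]; exact Ioc_subset_Icc_self
  have hcontF : ∀ ω : ℝ, ContinuousOn (fun x ↦ φ x * Real.sin (2 * π * x * ω)) (Icc (-lam) lam) :=
    fun ω ↦ hφ.mul (by fun_prop)
  have hcontF' : ∀ ω : ℝ,
      ContinuousOn (fun x ↦ φ x * ((2 * π * x) * Real.cos (2 * π * x * ω))) (Icc (-lam) lam) :=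
    fun ω ↦ hφ.mul (by fun_prop)
  have key := intervalIntegral.hasDerivAt_integral_of_dominated_loc_of_deriv_le
    (μ := (volume : Measure ℝ)) (a := -lam) (b := lam) (x₀ := ω₀) (s := univ)
    (F := fun ω x ↦ φ x * Real.sin (2 * π * x * ω))
    (F' := fun ω x ↦ φ x * ((2 * π * x) * Real.cos (2 * π * x * ω)))
    (bound := fun x ↦ |φ x| * (2 * π * lam)) univ_mem
    (Eventually.of_forall fun ω ↦
      ((hcontF ω).mono hIoc).aestronglyMeasurable measurableSet_uIoc)
    ((hcontF ω₀).intervalIntegrable_of_Icc hle)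
    (((hcontF' ω₀).mono hIoc).aestronglyMeasurable measurableSet_uIoc)
    (Eventually.of_forall fun x hx ω _ ↦ by
      have hx' : x ∈ Icc (-lam) lam := hIoc hx
      rw [Real.norm_eq_abs, abs_mul, abs_mul]
      refine mul_le_mul_of_nonneg_left ?_ (abs_nonneg _)
      have h1 : |2 * π * x| ≤ 2 * π * lam := by
        rw [abs_mul, abs_of_pos (by positivity : (0 : ℝ) < 2 * π)]
        exact mul_le_mul_of_nonneg_left (abs_le.2 ⟨by linarith [hx'.1], hx'.2⟩) (by positivity)
      have h2 : |Real.cos (2 * π * x * ω)| ≤ 1 := Real.abs_cos_le_one _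
      nlinarith [abs_nonneg (2 * π * x), abs_nonneg (Real.cos (2 * π * x * ω))])
    (((hφ.abs).mul continuousOn_const).intervalIntegrable_of_Icc hle)
    (Eventually.of_forall fun x _ ω _ ↦ by
      have h := (((hasDerivAt_id ω).const_mul (2 * π * x)).sin).const_mul (φ x)
      refine h.congr_deriv ?_
      simp only [id, mul_one]
      ring)
  exact key.2


/-- **The finite cosine transform of `h_{n,λ}` solves the prolate equation** (Slepian's commuting
miracle, divergence form integrated against the three kernels): with `g(ω) = ∫_{−λ}^{λ} f(x)cos(2πxω)dx`,
`(λ² − ω²) g″(ω) = 2ω g′(ω) + ((2πλω)² − χ) g(ω)` for every real `ω`, the derivatives written as the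
integrals `g′ = ∫ f(x)(−2πx)sin(2πxω)`, `g″ = ∫ f(x)(−2πx)(2πx)cos(2πxω)`.
[cite: SlepianPollak1961, §III; RokhlinXiao2007, Thm. 4 p. 110; ConnesConsani2021, §4 p. 16 eq. (prolateeq)] -/

theorem _root_.Literature.NumberTheory.LFunctions.IsProlateFunction.integral_mul_cos_ode
    (hf : IsProlateFunction lam n f) {χ : ℝ}
    (hχ : ∀ x ∈ Ioo (-lam) lam,
      -(deriv (fun y ↦ (lam ^ 2 - y ^ 2) * deriv f y) x) + (2 * π * lam * x) ^ 2 * f x = χ * f x)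
    (ω : ℝ) :
    (lam ^ 2 - ω ^ 2) *
        (∫ x in (-lam)..lam, (f x * (-(2 * π * x))) * ((2 * π * x) * Real.cos (2 * π * x * ω)))
      = 2 * ω * (∫ x in (-lam)..lam, f x * (-(2 * π * x) * Real.sin (2 * π * x * ω)))
        + ((2 * π * lam * ω) ^ 2 - χ) * (∫ x in (-lam)..lam, f x * Real.cos (2 * π * x * ω)) := by
  have hlam := hf.lam_pos
  have hle : -lam ≤ lam := by linarith
  have hfc : ContinuousOn f (Icc (-lam) lam) := hf.contDiffOn.continuousOn
  -- the flux `F = (λ² − x²) f′`, the Wronskian-type expression `W` and its derivative `w`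
  set F : ℝ → ℝ := fun x ↦ (lam ^ 2 - x ^ 2) * derivWithin f (Icc (-lam) lam) x with hF
  set W : ℝ → ℝ := fun x ↦ F x * Real.cos (2 * π * x * ω)
      - (lam ^ 2 - x ^ 2) * f x * (-(2 * π * ω) * Real.sin (2 * π * x * ω)) with hW
  set w : ℝ → ℝ := fun x ↦ ((2 * π * lam * x) ^ 2 - χ) * f x * Real.cos (2 * π * x * ω)
      - (-(2 * x)) * f x * (-(2 * π * ω) * Real.sin (2 * π * x * ω))
      - (lam ^ 2 - x ^ 2) * f x * (-(2 * π * ω) ^ 2 * Real.cos (2 * π * x * ω)) with hw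
  have hpc : ContinuousOn (fun x : ℝ ↦ lam ^ 2 - x ^ 2) (Icc (-lam) lam) := by fun_prop
  have hFc : ContinuousOn F (Icc (-lam) lam) := hpc.mul hf.continuousOn_derivWithin
  have hWc : ContinuousOn W (Icc (-lam) lam) :=
    (hFc.mul (by fun_prop)).sub ((hpc.mul hfc).mul (by fun_prop))
  have hwc : ContinuousOn w (Icc (-lam) lam) :=
    ((((by fun_prop : ContinuousOn (fun x : ℝ ↦ (2 * π * lam * x) ^ 2 - χ) (Icc (-lam) lam)).mul
      hfc).mul (by fun_prop)).sub
      (((by fun_prop : ContinuousOn (fun x : ℝ ↦ -(2 * x)) (Icc (-lam) lam)).mul hfc).mul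
        (by fun_prop))).sub ((hpc.mul hfc).mul (by fun_prop))
  have hWd : ∀ x ∈ Ioo (-lam) lam, HasDerivAt W (w x) x := by
    intro x hx
    have h1 : HasDerivAt F (((2 * π * lam * x) ^ 2 - χ) * f x) x := hf.hasDerivAt_flux hχ hx
    have h2 : HasDerivAt f (derivWithin f (Icc (-lam) lam) x) x := hf.hasDerivAt_derivWithin hx
    have hp : HasDerivAt (fun y : ℝ ↦ lam ^ 2 - y ^ 2) (-(2 * x)) x := by
      simpa using (hasDerivAt_pow 2 x).const_sub (lam ^ 2)
    have hk : HasDerivAt (fun y : ℝ ↦ Real.cos (2 * π * y * ω))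
        (-(2 * π * ω) * Real.sin (2 * π * x * ω)) x := by
      have := (((hasDerivAt_id x).const_mul (2 * π)).mul_const ω).cos
      refine this.congr_deriv ?_
      simp only [id, mul_one]; ring
    have hk' : HasDerivAt (fun y : ℝ ↦ -(2 * π * ω) * Real.sin (2 * π * y * ω))
        (-(2 * π * ω) ^ 2 * Real.cos (2 * π * x * ω)) x := by
      have := ((((hasDerivAt_id x).const_mul (2 * π)).mul_const ω).sin).const_mul (-(2 * π * ω))
      refine this.congr_deriv ?_
      simp only [id, mul_one]; ring
    have hWd' := (h1.mul hk).sub ((hp.mul h2).mul hk')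
    refine hWd'.congr_deriv ?_
    simp only [hw, hF, Pi.mul_apply]; ring
  have hint := intervalIntegral.integral_eq_sub_of_hasDerivAt_of_le hle hWc hWd
    (hwc.intervalIntegrable_of_Icc hle)
  have hWlam : W lam = 0 := by simp [hW, hF]
  have hWneg : W (-lam) = 0 := by simp [hW, hF]
  -- the three integrals
  have ha : IntervalIntegrable (fun x ↦ f x * Real.cos (2 * π * x * ω)) volume (-lam) lam :=
    (hfc.mul (by fun_prop)).intervalIntegrable_of_Icc hle
  have hb : IntervalIntegrable (fun x ↦ f x * (-(2 * π * x) * Real.sin (2 * π * x * ω)))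
      volume (-lam) lam :=
    (hfc.mul (by fun_prop)).intervalIntegrable_of_Icc hle
  have hc : IntervalIntegrable
      (fun x ↦ (f x * (-(2 * π * x))) * ((2 * π * x) * Real.cos (2 * π * x * ω))) volume (-lam) lam :=
    ((hfc.mul (by fun_prop)).mul (by fun_prop)).intervalIntegrable_of_Icc hle
  have hsplit : ∫ x in (-lam)..lam, w x =
      ((2 * π * lam * ω) ^ 2 - χ) * (∫ x in (-lam)..lam, f x * Real.cos (2 * π * x * ω))
        + 2 * ω * (∫ x in (-lam)..lam, f x * (-(2 * π * x) * Real.sin (2 * π * x * ω)))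
        - (lam ^ 2 - ω ^ 2) *
          (∫ x in (-lam)..lam, (f x * (-(2 * π * x))) * ((2 * π * x) * Real.cos (2 * π * x * ω))) := by
    rw [← intervalIntegral.integral_const_mul, ← intervalIntegral.integral_const_mul,
      ← intervalIntegral.integral_const_mul,
      ← intervalIntegral.integral_add (ha.const_mul _) (hb.const_mul _),
      ← intervalIntegral.integral_sub ((ha.const_mul _).add (hb.const_mul _)) (hc.const_mul _)]
    refine intervalIntegral.integral_congr fun x _ ↦ ?_
    simp only [hw]; ring
  rw [hWlam, hWneg, sub_zero, hsplit] at hint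
  linarith

/-- **Cauchy uniqueness at the regular point `0`, general form**: a `C²` solution `g` on `(−λ, λ)` of the
prolate equation with the eigenvalue `χ` of `f = h_{n,λ}`, continuous on `[−λ, λ]` and with `g′(0) = 0`, is
`(g(0)/f(0)) · f` on `[−λ, λ]` (the Cauchy problem for the regular linear equation on `[−μ, μ]`, `μ < λ`,
has a unique solution; the end points by continuity).  Same argument as
`IsProlateFunction.eq_mul_of_eigen_eq`. [cite: CoddingtonLevinson1955, Ch. 1 §7 & Ch. 8 §1; SlepianPollak1961, §III] -/
theorem _root_.Literature.NumberTheory.LFunctions.IsProlateFunction.eq_mul_of_ode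
    (hf : IsProlateFunction lam n f) {χ : ℝ}
    (hχf : ∀ x ∈ Ioo (-lam) lam,
      -(deriv (fun y ↦ (lam ^ 2 - y ^ 2) * deriv f y) x) + (2 * π * lam * x) ^ 2 * f x = χ * f x)
    {g g₁ g₂ : ℝ → ℝ} (hgc : ContinuousOn g (Icc (-lam) lam))
    (hg : ∀ x ∈ Ioo (-lam) lam, HasDerivAt g (g₁ x) x)
    (hg₁ : ∀ x ∈ Ioo (-lam) lam, HasDerivAt g₁ (g₂ x) x)
    (hode : ∀ x ∈ Ioo (-lam) lam,
      (lam ^ 2 - x ^ 2) * g₂ x = 2 * x * g₁ x + ((2 * π * lam * x) ^ 2 - χ) * g x)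
    (hg₁0 : g₁ 0 = 0) :
    ∀ x ∈ Icc (-lam) lam, g x = (g 0 / f 0) * f x := by
  have hlam := hf.lam_pos
  have hodef := hf.ode_of_eigen hχf
  set c : ℝ := g 0 / f 0 with hc
  have hf0 : f 0 ≠ 0 := hf.pos_zero.ne'
  -- the difference `h = g − c f`
  set h : ℝ → ℝ := fun x ↦ g x - c * f x with hh
  have hh0 : h 0 = 0 := by simp only [hh, hc]; field_simp; ring
  have hdh : ∀ x ∈ Ioo (-lam) lam, HasDerivAt h (g₁ x - c * deriv f x) x := fun x hx ↦
    (hg x hx).sub (((hf.differentiableAt hx).hasDerivAt).const_mul c)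
  have hdh' : ∀ x ∈ Ioo (-lam) lam,
      HasDerivAt (fun y ↦ g₁ y - c * deriv f y) (g₂ x - c * deriv (deriv f) x) x := fun x hx ↦
    (hg₁ x hx).sub (((hf.differentiableAt_deriv hx).hasDerivAt).const_mul c)
  -- interior: ODE uniqueness on `(−μ, μ)`
  have hin : ∀ x ∈ Ioo (-lam) lam, h x = 0 := by
    intro x hx
    set μ : ℝ := (|x| + lam) / 2 with hμ
    have hxabs : |x| < lam := abs_lt.mpr ⟨hx.1, hx.2⟩
    have hμlam : μ < lam := by rw [hμ]; linarith
    have hμpos : 0 < μ := by rw [hμ]; linarith [abs_nonneg x]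
    have hxμ : x ∈ Ioo (-μ) μ := by
      rw [hμ]; constructor <;> cases abs_lt.mp (show |x| < (|x| + lam) / 2 by linarith) <;> linarith
    have hsub : Ioo (-μ) μ ⊆ Ioo (-lam) lam := Ioo_subset_Ioo (by linarith) hμlam.le
    let v : ℝ → ℝ × ℝ → ℝ × ℝ := fun t Y ↦
      (Y.2, (2 * t * Y.2 + ((2 * π * lam * t) ^ 2 - χ) * Y.1) / (lam ^ 2 - t ^ 2))
    set L : ℝ := (2 * lam + ((2 * π * lam * lam) ^ 2 + |χ|)) / (lam ^ 2 - μ ^ 2) + 1 with hL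
    have hden : 0 < lam ^ 2 - μ ^ 2 := by nlinarith
    have hLpos : 0 < L := by rw [hL]; positivity
    have hv : ∀ t ∈ Ioo (-μ) μ, LipschitzOnWith (Real.toNNReal L) (v t) univ := by
      intro t ht
      have htabs : |t| < μ := abs_lt.mpr ⟨ht.1, ht.2⟩
      have hpt : lam ^ 2 - μ ^ 2 ≤ lam ^ 2 - t ^ 2 := by nlinarith [abs_nonneg t, sq_abs t]
      have hpt0 : 0 < lam ^ 2 - t ^ 2 := lt_of_lt_of_le hden hpt
      refine (LipschitzWith.of_dist_le_mul fun Y Z ↦ ?_).lipschitzOnWith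
      rw [Real.coe_toNNReal _ hLpos.le]
      have hd1 : dist Y.1 Z.1 ≤ dist Y Z := by rw [Prod.dist_eq]; exact le_max_left _ _
      have hd2 : dist Y.2 Z.2 ≤ dist Y Z := by rw [Prod.dist_eq]; exact le_max_right _ _
      rw [Real.dist_eq] at hd1 hd2
      have hdYZ : 0 ≤ dist Y Z := dist_nonneg
      rw [Prod.dist_eq]
      refine max_le ?_ ?_
      · rw [Real.dist_eq]
        calc |Y.2 - Z.2| ≤ dist Y Z := hd2
          _ = 1 * dist Y Z := (one_mul _).symm
          _ ≤ L * dist Y Z := by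
              gcongr; rw [hL]
              linarith [show 0 ≤ (2 * lam + ((2 * π * lam * lam) ^ 2 + |χ|)) / (lam ^ 2 - μ ^ 2) by
                positivity]
      · rw [Real.dist_eq, ← sub_div, abs_div, abs_of_pos hpt0]
        have hcoef1 : |2 * t| ≤ 2 * lam := by rw [abs_mul, abs_two]; linarith
        have hcoef2 : |(2 * π * lam * t) ^ 2 - χ| ≤ (2 * π * lam * lam) ^ 2 + |χ| := by
          refine (abs_sub _ _).trans (add_le_add ?_ le_rfl)
          rw [abs_pow, pow_le_pow_iff_left₀ (abs_nonneg _) (by positivity) two_ne_zero, abs_mul,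
            abs_of_pos (by positivity : 0 < 2 * π * lam)]
          exact mul_le_mul_of_nonneg_left (by linarith) (by positivity)
        have hnum : |2 * t * Y.2 + ((2 * π * lam * t) ^ 2 - χ) * Y.1
              - (2 * t * Z.2 + ((2 * π * lam * t) ^ 2 - χ) * Z.1)|
            ≤ (2 * lam + ((2 * π * lam * lam) ^ 2 + |χ|)) * dist Y Z := by
          have e : 2 * t * Y.2 + ((2 * π * lam * t) ^ 2 - χ) * Y.1
              - (2 * t * Z.2 + ((2 * π * lam * t) ^ 2 - χ) * Z.1)
              = 2 * t * (Y.2 - Z.2) + ((2 * π * lam * t) ^ 2 - χ) * (Y.1 - Z.1) := by ring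
          rw [e]
          refine (abs_add_le _ _).trans ?_
          rw [abs_mul (2 * t), abs_mul ((2 * π * lam * t) ^ 2 - χ), add_mul]
          exact add_le_add (mul_le_mul hcoef1 hd2 (abs_nonneg _) (by linarith))
            (mul_le_mul hcoef2 hd1 (abs_nonneg _) (by positivity))
        calc |2 * t * Y.2 + ((2 * π * lam * t) ^ 2 - χ) * Y.1
                - (2 * t * Z.2 + ((2 * π * lam * t) ^ 2 - χ) * Z.1)| / (lam ^ 2 - t ^ 2)
            ≤ (2 * lam + ((2 * π * lam * lam) ^ 2 + |χ|)) * dist Y Z / (lam ^ 2 - μ ^ 2) := by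
              gcongr
          _ = ((2 * lam + ((2 * π * lam * lam) ^ 2 + |χ|)) / (lam ^ 2 - μ ^ 2)) * dist Y Z := by
              ring
          _ ≤ L * dist Y Z := by gcongr; rw [hL]; linarith
    -- the solution `(h, h′)` and the zero solution
    have hY : ∀ t ∈ Ioo (-μ) μ,
        HasDerivAt (fun s ↦ (h s, g₁ s - c * deriv f s))
          (v t (h t, g₁ t - c * deriv f t)) t
          ∧ (h t, g₁ t - c * deriv f t) ∈ univ := by
      intro t ht
      have ht' := hsub ht
      have hpt0 : lam ^ 2 - t ^ 2 ≠ 0 := by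
        have : |t| < lam := abs_lt.mpr ⟨ht'.1, ht'.2⟩; nlinarith [abs_nonneg t, sq_abs t]
      refine ⟨?_, mem_univ _⟩
      have hd := (hdh t ht').prodMk (hdh' t ht')
      convert hd using 2
      rw [div_eq_iff hpt0]
      have e1 := hode t ht'
      have e2 := hodef t ht'
      simp only [hh]
      linear_combination -e1 + c * e2
    have hZ : ∀ t ∈ Ioo (-μ) μ,
        HasDerivAt (fun _ : ℝ ↦ ((0 : ℝ), (0 : ℝ))) (v t ((0 : ℝ), (0 : ℝ))) t
          ∧ ((0 : ℝ), (0 : ℝ)) ∈ univ := by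
      intro t ht
      refine ⟨?_, mem_univ _⟩
      have : v t ((0 : ℝ), (0 : ℝ)) = ((0 : ℝ), (0 : ℝ)) := by
        simp only [v, mul_zero, add_zero, zero_div]
      rw [this]
      exact hasDerivAt_const t _
    have h0μ : (0 : ℝ) ∈ Ioo (-μ) μ := ⟨by linarith, hμpos⟩
    have heq : (fun s ↦ (h s, g₁ s - c * deriv f s)) 0 = (fun _ : ℝ ↦ ((0 : ℝ), (0 : ℝ))) 0 := by
      simp only [hh0, hg₁0, hf.deriv_zero, mul_zero, sub_zero]
    have hE := ODE_solution_unique_of_mem_Ioo hv h0μ hY hZ heq hxμ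
    have := congrArg Prod.fst hE
    simpa using this
  -- conclusion on `(−λ, λ)`
  have hin' : ∀ x ∈ Ioo (-lam) lam, g x = c * f x := fun x hx ↦ by
    have := hin x hx; simp only [hh] at this; linarith
  -- the end points by continuity from inside
  have hcf : ContinuousOn (fun x ↦ c * f x) (Icc (-lam) lam) :=
    continuousOn_const.mul hf.contDiffOn.continuousOn
  have hclos : closure (Ioo (-lam) lam) = Icc (-lam) lam := closure_Ioo (by linarith)
  intro x hx
  have hx' : x ∈ closure (Ioo (-lam) lam) := by rw [hclos]; exact hx
  haveI : (𝓝[Ioo (-lam) lam] x).NeBot := mem_closure_iff_nhdsWithin_neBot.mp hx'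
  have T1 : Tendsto g (𝓝[Ioo (-lam) lam] x) (𝓝 (g x)) :=
    ((hgc.continuousWithinAt hx).mono Ioo_subset_Icc_self).tendsto
  have T2 : Tendsto (fun t ↦ c * f t) (𝓝[Ioo (-lam) lam] x) (𝓝 (c * f x)) :=
    ((hcf.continuousWithinAt hx).mono Ioo_subset_Icc_self).tendsto
  have hev : g =ᶠ[𝓝[Ioo (-lam) lam] x] fun t ↦ c * f t := by
    filter_upwards [self_mem_nhdsWithin] with t ht using hin' t ht
  exact tendsto_nhds_unique (T1.congr' hev) T2

/-- **Slepian–Pollak: the prolate function `h_{n,λ}` is an eigenfunction of the finite cosine (= Fourier,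
`h` being even) transform of band `[−λ, λ]`**: `∫_{−λ}^{λ} h(x) cos(2πxω) dx = μ · h(ω)` for `ω ∈ [−λ, λ]`,
with `μ = (∫_{−λ}^{λ} h)/h(0)` (evaluate at `ω = 0`).  At `λ = 1` this is CC's (prolateeq)/(cosalphan).
[cite: SlepianPollak1961, §III; RokhlinXiao2007, Thm. 3–4 pp. 109–110; ConnesConsani2021, §4 p. 16 eq. (prolateeq), (cosalphan)] -/
theorem _root_.Literature.NumberTheory.LFunctions.IsProlateFunction.integral_mul_cos_eq_mul
    (hf : IsProlateFunction lam n f) {ω : ℝ} (hω : ω ∈ Icc (-lam) lam) :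
    ∫ x in (-lam)..lam, f x * Real.cos (2 * π * x * ω)
      = ((∫ x in (-lam)..lam, f x) / f 0) * f ω := by
  have hlam := hf.lam_pos
  obtain ⟨χ, hχ⟩ := hf.eigen
  have hfc : ContinuousOn f (Icc (-lam) lam) := hf.contDiffOn.continuousOn
  set g : ℝ → ℝ := fun ω ↦ ∫ x in (-lam)..lam, f x * Real.cos (2 * π * x * ω) with hg
  set g₁ : ℝ → ℝ := fun ω ↦
    ∫ x in (-lam)..lam, f x * (-(2 * π * x) * Real.sin (2 * π * x * ω)) with hg₁
  set g₂ : ℝ → ℝ := fun ω ↦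
    ∫ x in (-lam)..lam, (f x * (-(2 * π * x))) * ((2 * π * x) * Real.cos (2 * π * x * ω)) with hg₂
  have hd1 : ∀ ω, HasDerivAt g (g₁ ω) ω := fun ω ↦ hasDerivAt_integral_mul_cos hlam hfc ω
  have hd2 : ∀ ω, HasDerivAt g₁ (g₂ ω) ω := by
    intro ω
    have hφ : ContinuousOn (fun x ↦ f x * (-(2 * π * x))) (Icc (-lam) lam) := hfc.mul (by fun_prop)
    have e : g₁ = fun ω ↦ ∫ x in (-lam)..lam, (f x * (-(2 * π * x))) * Real.sin (2 * π * x * ω) := by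
      funext ω
      simp only [hg₁]
      exact intervalIntegral.integral_congr fun x _ ↦ by ring
    rw [e]
    exact hasDerivAt_integral_mul_sin hlam hφ ω
  have hg₁0 : g₁ 0 = 0 := by simp [hg₁]
  have hgc : ContinuousOn g (Icc (-lam) lam) := fun ω _ ↦ (hd1 ω).continuousAt.continuousWithinAt
  have hode : ∀ ω ∈ Ioo (-lam) lam,
      (lam ^ 2 - ω ^ 2) * g₂ ω = 2 * ω * g₁ ω + ((2 * π * lam * ω) ^ 2 - χ) * g ω :=
    fun ω _ ↦ hf.integral_mul_cos_ode hχ ω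
  have key := hf.eq_mul_of_ode hχ hgc (fun ω _ ↦ hd1 ω) (fun ω _ ↦ hd2 ω) hode hg₁0 ω hω
  have hg0 : g 0 = ∫ x in (-lam)..lam, f x := by simp [hg]
  rw [hg0] at key
  exact key


/-- **(cosalphan) DISCHARGED**: `∫_{−1}^{1} φ_n(x) e^{2πixω} dx = λ(n) φ_n(ω)` for `ω ∈ [−1, 1]`, from
`IsProlateFunction.integral_mul_cos_eq_mul` (the sine part vanishes, `φ_n` being even).
[cite: ConnesConsani2021, §4 p. 16 eq. (prolateeq), (cosalphan); SlepianPollak1961, §III; RokhlinXiao2007, Thm. 4 p. 110] -/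
theorem CC2021_sec4_cosalphan_holds : CC2021_sec4_cosalphan := by
  intro n ω hω
  have hf := isProlateFunction_prolateFun n
  have hfc : ContinuousOn (prolateFun n) (Icc (-1 : ℝ) 1) := hf.contDiffOn.continuousOn
  have hcos := hf.integral_mul_cos_eq_mul hω
  have hsin : ∫ x in (-1 : ℝ)..1, prolateFun n x * Real.sin (2 * π * x * ω) = 0 := by
    have h : (∫ x in (-1 : ℝ)..1, prolateFun n (-x) * Real.sin (2 * π * (-x) * ω))
        = ∫ x in (-1 : ℝ)..1, prolateFun n x * Real.sin (2 * π * x * ω) := by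
      simpa only [neg_neg] using intervalIntegral.integral_comp_neg (a := (-1 : ℝ)) (b := 1)
        (fun x ↦ prolateFun n x * Real.sin (2 * π * x * ω))
    have h2 : (∫ x in (-1 : ℝ)..1, prolateFun n (-x) * Real.sin (2 * π * (-x) * ω))
        = -∫ x in (-1 : ℝ)..1, prolateFun n x * Real.sin (2 * π * x * ω) := by
      rw [← intervalIntegral.integral_neg]
      refine intervalIntegral.integral_congr fun x _ ↦ ?_
      simp only [prolateFun_neg]
      rw [show 2 * π * (-x) * ω = -(2 * π * x * ω) by ring, Real.sin_neg]
      ring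
    linarith
  have hc1 : ContinuousOn (fun x : ℝ ↦ ((prolateFun n x * Real.cos (2 * π * x * ω) : ℝ) : ℂ))
      (Icc (-1 : ℝ) 1) :=
    Complex.continuous_ofReal.comp_continuousOn (hfc.mul (by fun_prop))
  have hc2 : ContinuousOn (fun x : ℝ ↦ ((prolateFun n x * Real.sin (2 * π * x * ω) : ℝ) : ℂ) * I)
      (Icc (-1 : ℝ) 1) :=
    (Complex.continuous_ofReal.comp_continuousOn (hfc.mul (by fun_prop))).mul continuousOn_const
  have hint : ∫ x in (-1 : ℝ)..1, (prolateFun n x : ℂ) * cexp (2 * π * I * x * ω)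
      = ((∫ x in (-1 : ℝ)..1, prolateFun n x * Real.cos (2 * π * x * ω) : ℝ) : ℂ)
        + ((∫ x in (-1 : ℝ)..1, prolateFun n x * Real.sin (2 * π * x * ω) : ℝ) : ℂ) * I := by
    have e : (fun x : ℝ ↦ (prolateFun n x : ℂ) * cexp (2 * π * I * x * ω))
        = fun x : ℝ ↦ ((prolateFun n x * Real.cos (2 * π * x * ω) : ℝ) : ℂ)
          + ((prolateFun n x * Real.sin (2 * π * x * ω) : ℝ) : ℂ) * I := by
      funext x
      have : (2 * π * I * x * ω : ℂ) = ((2 * π * x * ω : ℝ) : ℂ) * I := by push_cast; ring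
      rw [this, Complex.exp_mul_I, ← Complex.ofReal_cos, ← Complex.ofReal_sin]
      push_cast; ring
    rw [e, intervalIntegral.integral_add (hc1.intervalIntegrable_of_Icc (by norm_num))
        (hc2.intervalIntegrable_of_Icc (by norm_num)), intervalIntegral.integral_mul_const,
      intervalIntegral.integral_ofReal, intervalIntegral.integral_ofReal]
  rw [hint, hsin, hcos, prolateEigen_eq_intervalIntegral]
  push_cast; ring

/-! ## Proposition 4.5 (i): `𝒫₁ η_n = λ(n) ξ_n` -/

/-- `∫_ℝ φ_n(v) k(v) dv = ∫_{−1}^{1} φ_n(v) k(v) dv` (support of `φ_n`). [folklore] -/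
private theorem integral_prolateFun_mul (n : ℕ) (k : ℝ → ℂ) :
    ∫ v, (prolateFun n v : ℂ) * k v = ∫ v in (-1 : ℝ)..1, (prolateFun n v : ℂ) * k v := by
  have h : (fun v ↦ (prolateFun n v : ℂ) * k v)
      = (Icc (-1 : ℝ) 1).indicator (fun v ↦ (prolateFun n v : ℂ) * k v) := by
    funext v
    by_cases hv : v ∈ Icc (-1 : ℝ) 1
    · rw [indicator_of_mem hv]
    · rw [indicator_of_notMem hv, prolateFun_eq_zero_of_notMem hv]; simp
  conv_lhs => rw [h]
  rw [integral_indicator measurableSet_Icc, integral_Icc_eq_integral_Ioc,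
    ← intervalIntegral.integral_of_le (by norm_num : (-1 : ℝ) ≤ 1)]

/-- **`η_n = λ(n) φ_n` on `[−1, 1]`** (pointwise, for the continuous representative
`η_n = 𝓕ξ_n`): eq. (chirem0.5) before projecting. [cite: ConnesConsani2021, Prop. 4.5 (i) §4 p. 16 eq. (chirem0.5); eq. (cosalphan) p. 16] -/
theorem prolateEtaFun_eq_of_mem (n : ℕ) {x : ℝ} (hx : x ∈ Icc (-1 : ℝ) 1) :
    prolateEtaFun n x = (prolateEigen n : ℂ) * prolateFun n x := by
  have hx' : -x ∈ Icc (-1 : ℝ) 1 := ⟨by linarith [hx.2], by linarith [hx.1]⟩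
  have key := CC2021_sec4_cosalphan_holds n (-x) hx'
  rw [prolateFun_neg] at key
  rw [prolateEtaFun, Real.fourier_real_eq_integral_exp_smul]
  have e : (fun v : ℝ ↦ cexp (↑(-2 * π * v * x) * I) • prolateXiFun n v)
      = fun v : ℝ ↦ (prolateFun n v : ℂ) * cexp (2 * π * I * v * ↑(-x)) := by
    funext v
    simp only [prolateXiFun, smul_eq_mul]
    rw [mul_comm]
    congr 2
    push_cast; ring
  rw [e, integral_prolateFun_mul, key]

/-- **Proposition 4.5 (i) DISCHARGED**: `𝒫₁ η_n = λ(n) ξ_n` in `L²(ℝ)`. [cite: ConnesConsani2021, Prop. 4.5 (i) §4 p. 16 eq. (chirem0.5)] -/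
theorem CC2021_prop_4_5_i_holds : CC2021_prop_4_5_i := by
  intro n
  apply Lp.ext
  filter_upwards [cutoffProj_coeFn 1 (prolateEta n), prolateEta_coeFn n,
    Lp.coeFn_smul (prolateEigen n : ℂ) (prolateXi n), prolateXi_coeFn n] with x h1 h2 h3 h4
  rw [h1, h3, Pi.smul_apply, h4, smul_eq_mul]
  by_cases hx : x ∈ Icc (-1 : ℝ) 1
  · rw [indicator_of_mem hx, h2, prolateEtaFun_eq_of_mem n hx]
    rfl
  · rw [indicator_of_notMem hx]
    simp [prolateXiFun, prolateFun_eq_zero_of_notMem hx]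

/-- `ψ_n = η_n − λ(n) ξ_n` in `L²(ℝ)` (`ψ_n = Pη_n = η_n − 𝒫₁η_n`). [cite: ConnesConsani2021, Prop. 4.5 (i) §4 p. 16] -/
theorem prolatePsi_eq (n : ℕ) : prolatePsi n = prolateEta n - (prolateEigen n : ℂ) • prolateXi n := by
  rw [prolatePsi, outerProj_apply, CC2021_prop_4_5_i_holds n]

/-- `‖𝒫₁ η_n‖ = |λ(n)|`. [cite: ConnesConsani2021, Prop. 4.5 (i) §4 p. 16] -/
theorem norm_cutoffProj_prolateEta (n : ℕ) : ‖cutoffProj 1 (prolateEta n)‖ = |prolateEigen n| := by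
  rw [CC2021_prop_4_5_i_holds n, norm_smul, norm_prolateXi, mul_one, Complex.norm_real,
    Real.norm_eq_abs]

/-- **`‖ψ_n‖ = √(1 − λ(n)²)`** (Prop. 4.5 (iii), the norm: `‖η_n‖² = ‖𝒫₁η_n‖² + ‖Pη_n‖²`).
[cite: ConnesConsani2021, Prop. 4.5 (iii) §4 p. 16] -/
theorem norm_prolatePsi (n : ℕ) : ‖prolatePsi n‖ = Real.sqrt (1 - prolateEigen n ^ 2) := by
  have h := starProj_norm_sq_eq_add (isStarProjection_cutoffProj 1) (prolateEta n)
  rw [norm_prolateEta, norm_cutoffProj_prolateEta, sq_abs, ← outerProj_apply] at h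
  have h2 : ‖prolatePsi n‖ ^ 2 = 1 - prolateEigen n ^ 2 := by
    rw [prolatePsi]; nlinarith [h]
  rw [← h2, Real.sqrt_sq (norm_nonneg _)]

/-- `|λ(n)| ≤ 1` (`‖𝒫₁η_n‖ ≤ ‖η_n‖ = 1`). [cite: ConnesConsani2021, §4 p. 16; Connes2026Letter, §6.3 Fact 6.3] -/
theorem abs_prolateEigen_le_one (n : ℕ) : |prolateEigen n| ≤ 1 := by
  have h := starProj_norm_sq_eq_add (isStarProjection_cutoffProj 1) (prolateEta n)
  rw [norm_prolateEta, norm_cutoffProj_prolateEta] at h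
  nlinarith [sq_nonneg ‖prolateEta n - cutoffProj 1 (prolateEta n)‖, abs_nonneg (prolateEigen n)]

/-- `η_n = 𝓕 ξ_n` is continuous (Fourier transform of an `L¹` function). [cite: ConnesConsani2021, Remark 4.6 (i) §4 p. 18 ("the function `𝔽_{e_ℝ}ξ_n` is smooth")] -/
theorem continuous_prolateEtaFun (n : ℕ) : Continuous (prolateEtaFun n) :=
  Literature.Analysis.FluidPDE.FourierNS.continuous_fourierIntegral (integrable_prolateXiFun n)

/-- **`|λ(n)| < 1`** (part of the printed "`ν_n = λ(n)² < 1`"): if `|λ(n)| = 1` then `Pη_n = 0`, so the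
Fourier transform of the compactly supported `ξ_n` would vanish on `(1, ∞)`, hence identically
(it is entire — the tree's `fourier_eq_zero_of_eqOn_Ioo`), contradicting `η_n(0) = λ(n)φ_n(0) ≠ 0`.
[cite: ConnesConsani2021, §4 p. 16; Connes2026Letter, §6.3 Fact 6.3; RokhlinXiao2007, Thm. 3 p. 109] -/
theorem abs_prolateEigen_lt_one (n : ℕ) : |prolateEigen n| < 1 := by
  refine lt_of_le_of_ne (abs_prolateEigen_le_one n) fun h1 ↦ ?_
  have hP := starProj_norm_sq_eq_add (isStarProjection_cutoffProj 1) (prolateEta n)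
  rw [norm_prolateEta, norm_cutoffProj_prolateEta, h1] at hP
  have h0 : prolateEta n - cutoffProj 1 (prolateEta n) = 0 := by
    have : ‖prolateEta n - cutoffProj 1 (prolateEta n)‖ ^ 2 = 0 := by linarith
    exact norm_eq_zero.mp (pow_eq_zero_iff two_ne_zero |>.mp this)
  -- `η_n = 0` a.e. off `[−1, 1]`
  have hae : ∀ᵐ x : ℝ, x ∉ Icc (-1 : ℝ) 1 → prolateEtaFun n x = 0 := by
    have h2 : (prolateEta n : ℝ → ℂ) =ᵐ[volume] (cutoffProj 1 (prolateEta n) : ℝ → ℂ) := by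
      have h3 := Lp.coeFn_sub (prolateEta n) (cutoffProj 1 (prolateEta n))
      rw [h0] at h3
      filter_upwards [h3, Lp.coeFn_zero ℂ 2 (volume : Measure ℝ)] with x hx hz
      rw [hz, Pi.sub_apply] at hx
      exact (sub_eq_zero.mp hx.symm)
    filter_upwards [h2, cutoffProj_coeFn 1 (prolateEta n), prolateEta_coeFn n] with x hx h3 h4 hxI
    rw [← h4, hx, h3, indicator_of_notMem hxI]
  -- hence everywhere on `(1, 2)` by continuity
  have hzero : ∀ y ∈ Ioo (1 : ℝ) 2, prolateEtaFun n y = 0 := by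
    have hae' : prolateEtaFun n =ᵐ[volume.restrict (Ioo (1 : ℝ) 2)] fun _ ↦ (0 : ℂ) := by
      refine (ae_restrict_iff' measurableSet_Ioo).mpr ?_
      filter_upwards [hae] with x hx hxI
      exact hx fun h ↦ by linarith [h.2, hxI.1]
    intro y hy
    exact Measure.eqOn_Ioo_of_ae_eq volume hae' (continuous_prolateEtaFun n).continuousOn
      continuousOn_const hy
  -- so `𝓕 ξ_n = 0` identically, in particular at `0`
  have hall := Literature.Analysis.Fourier.fourier_eq_zero_of_eqOn_Ioo (integrable_prolateXiFun n)
    zero_le_one (fun x hx ↦ by simp [prolateXiFun, prolateFun_eq_zero_of_notMem hx])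
    (by norm_num : (1 : ℝ) < 2) hzero 0
  have h00 := prolateEtaFun_eq_of_mem n (x := 0) ⟨by norm_num, by norm_num⟩
  rw [prolateEtaFun] at h00
  rw [h00] at hall
  have hlam : (prolateEigen n : ℂ) ≠ 0 := by
    have : prolateEigen n ≠ 0 := fun h ↦ by rw [h, abs_zero] at h1; norm_num at h1
    exact_mod_cast this
  exact mul_ne_zero hlam (by exact_mod_cast (prolateFun_zero_pos n).ne') hall

/-- `η_n` is real valued: `conj η_n(v) = η_n(v)` (`φ_n` real and even). [cite: ConnesConsani2021, Prop. 4.5 (iii) §4 p. 16 ("real valued")] -/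
theorem conj_prolateEtaFun (n : ℕ) (v : ℝ) : conj (prolateEtaFun n v) = prolateEtaFun n v := by
  rw [prolateEtaFun, Real.fourier_real_eq_integral_exp_smul, ← integral_conj]
  have e : (fun x : ℝ ↦ conj (cexp (↑(-2 * π * x * v) * I) • prolateXiFun n x))
      = fun x : ℝ ↦ cexp (↑(-2 * π * (-x) * v) * I) • prolateXiFun n (-x) := by
    funext x
    simp only [prolateXiFun, smul_eq_mul, map_mul, Complex.conj_ofReal, ← Complex.exp_conj,
      Complex.conj_I, prolateFun_neg]
    congr 2
    push_cast; ring
  rw [e]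
  exact integral_neg_eq_self
    (fun x : ℝ ↦ cexp (↑(-2 * π * x * v) * I) • prolateXiFun n x) volume

/-- **`ψ_n` is real valued** (Prop. 4.5 (iii)). [cite: ConnesConsani2021, Prop. 4.5 (iii) §4 p. 16] -/
theorem conj_prolatePsiFun (n : ℕ) (v : ℝ) : conj (prolatePsiFun n v) = prolatePsiFun n v := by
  unfold prolatePsiFun cutoffP
  split_ifs
  · exact conj_prolateEtaFun n v
  · simp

/-- `⟪η_n, η_m⟫ = ⟪ξ_n, ξ_m⟫` (Plancherel). [cite: ConnesConsani2021, Prop. 4.5 (iii) proof §4 p. 17] -/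
theorem inner_prolateEta (n m : ℕ) : ⟪prolateEta n, prolateEta m⟫_ℂ = ⟪prolateXi n, prolateXi m⟫_ℂ :=
  Lp.inner_fourier_eq (prolateXi n) (prolateXi m)

/-- `⟪η_n, ξ_m⟫ = λ(n)⟪ξ_n, ξ_m⟫` (`ξ_m = 𝒫₁ξ_m`, `𝒫₁` self-adjoint, (i)). [cite: ConnesConsani2021, Prop. 4.5 (iii) proof §4 p. 17] -/
theorem inner_prolateEta_prolateXi (n m : ℕ) :
    ⟪prolateEta n, prolateXi m⟫_ℂ = (prolateEigen n : ℂ) * ⟪prolateXi n, prolateXi m⟫_ℂ := by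
  have hadj : ContinuousLinearMap.adjoint (cutoffProj 1) = cutoffProj 1 :=
    (cutoffProj_isSelfAdjoint 1).adjoint_eq
  conv_lhs => rw [← cutoffProj_prolateXi m, ← hadj, ContinuousLinearMap.adjoint_inner_right,
    CC2021_prop_4_5_i_holds n, inner_smul_left, Complex.conj_ofReal]

/-- `⟪ξ_n, ξ_m⟫ = δ_{nm}`. [cite: ConnesConsani2021, Prop. 4.5 proof §4 p. 17] -/
theorem inner_prolateXi_eq_ite (n m : ℕ) :
    ⟪prolateXi n, prolateXi m⟫_ℂ = if n = m then (1 : ℂ) else 0 :=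
  orthonormal_iff_ite.mp CC2021_sec4_xi_orthonormal_holds n m

/-- **The `ψ_n` are pairwise orthogonal** (Prop. 4.5 (iii)). [cite: ConnesConsani2021, Prop. 4.5 (iii) §4 p. 16] -/
theorem inner_prolatePsi_eq_zero {n m : ℕ} (h : n ≠ m) : ⟪prolatePsi n, prolatePsi m⟫_ℂ = 0 := by
  have h1 := inner_prolateXi_eq_ite n m
  rw [if_neg h] at h1
  have h2 := inner_prolateEta_prolateXi n m
  have h1' := inner_prolateXi_eq_ite m n
  rw [if_neg (Ne.symm h)] at h1'
  have h3 : ⟪prolateXi n, prolateEta m⟫_ℂ = 0 := by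
    rw [← inner_conj_symm, inner_prolateEta_prolateXi m n, h1']
    simp
  rw [h1, mul_zero] at h2
  rw [prolatePsi_eq, prolatePsi_eq, inner_sub_left, inner_sub_right, inner_sub_right,
    inner_smul_left, inner_smul_left, inner_smul_right, inner_smul_right, inner_prolateEta, h1, h2,
    h3]
  ring

/-! ## Proposition 4.5 (iv): the (hattrick) identity

Printed proof (p. 17): `η_n = 𝔽ξ_n` is a unit vector with `η_n = λ(n)ξ_n + √(1−λ(n)²)ζ_n`; since
`𝔽 ∘ ϑ(ρ) = ϑ(ρ⁻¹) ∘ 𝔽` and `ξ_n` is real and even, `⟨η_n|ϑ(ρ)η_n⟩ = ⟨ξ_n|ϑ(ρ)ξ_n⟩`; expand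
bilinearly and divide by `1 − λ(n)² > 0`. -/

section Hattrick

/-- `repCoeff` only depends on the a.e. classes of its arguments (dilations preserve null sets).
[folklore] -/
private theorem repCoeff_congr_ae {u u' v v' : ℝ → ℂ} (hu : u =ᵐ[volume] u') (hv : v =ᵐ[volume] v')
    (ρ : ℝ) : repCoeff u v ρ = repCoeff u' v' ρ := by
  unfold repCoeff scalingCoeff
  refine integral_congr_ae ?_
  have hv' := Literature.Analysis.OperatorTheory.ae_eq_comp_smul (V := ℝ) hv
    (Real.exp_pos (-(-Real.log ρ))).ne'
  filter_upwards [hu, hv'] with x hx hx'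
  simp only [smul_eq_mul] at hx'
  rw [hx, hx']

/-- `⟨ξ|ϑ(ρ⁻¹)η⟩ = √ρ ⟪ξ, D_ρ η⟫_{L²}` for `L²` classes, `ρ > 0`. [cite: ConnesConsani2021, §4 eq. (40) p. 15] -/
private theorem repCoeff_eq_inner_lpDilation (ξ η : Lp ℂ 2 (volume : Measure ℝ)) {ρ : ℝ}
    (hρ : 0 < ρ) : repCoeff ξ η ρ = (Real.sqrt ρ : ℂ) * ⟪ξ, lpDilation (V := ℝ) (F := ℂ) (p := (2 : ℝ≥0∞)) ρ hρ.ne' ENNReal.ofNat_ne_top η⟫_ℂ := by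
  rw [repCoeff_eq hρ, MeasureTheory.L2.inner_def, ← integral_const_mul]
  refine integral_congr_ae ?_
  filter_upwards [lpDilation_coeFn (V := ℝ) (F := ℂ) (p := (2 : ℝ≥0∞)) hρ.ne'
    ENNReal.ofNat_ne_top η] with x hx
  rw [RCLike.inner_apply, hx, smul_eq_mul]
  ring

/-- **`D_ρ ∘ 𝔽 = ρ⁻¹ · 𝔽 ∘ D_{ρ⁻¹}` on `L²(ℝ)`** (the dilation law of the Fourier transform, from the
tree's `fourier_toLp_comp_smul`): "`𝔽_{e_ℝ} ∘ ϑ(λ) = ϑ(λ⁻¹) ∘ 𝔽_{e_ℝ}`". [cite: ConnesConsani2021, Prop. 4.5 (iv) proof §4 p. 17] -/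
private theorem lpDilation_fourier {ρ : ℝ} (hρ : 0 < ρ) (b : Lp ℂ 2 (volume : Measure ℝ)) :
    lpDilation (V := ℝ) (F := ℂ) (p := (2 : ℝ≥0∞)) ρ hρ.ne' ENNReal.ofNat_ne_top (𝓕 b : Lp ℂ 2 (volume : Measure ℝ)) =
      (ρ⁻¹ : ℂ) • (𝓕 (lpDilation (V := ℝ) (F := ℂ) (p := (2 : ℝ≥0∞)) (ρ⁻¹) ((inv_pos.2 hρ).ne') ENNReal.ofNat_ne_top b) : Lp ℂ 2 (volume : Measure ℝ)) := by
  have hρ' : (ρ⁻¹ : ℝ) ≠ 0 := (inv_pos.2 hρ).ne'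
  have key := Literature.Analysis.FunctionSpaces.fourier_toLp_comp_smul hρ' b
  have e1 : lpDilation (V := ℝ) (F := ℂ) (p := (2 : ℝ≥0∞)) (ρ⁻¹) hρ' ENNReal.ofNat_ne_top b =
      (Literature.Analysis.FunctionSpaces.memLp_comp_smul_fun (Lp.memLp b) hρ').toLp _ := by
    apply Lp.ext
    filter_upwards [lpDilation_coeFn (V := ℝ) (F := ℂ) (p := (2 : ℝ≥0∞)) hρ' ENNReal.ofNat_ne_top b,
      (Literature.Analysis.FunctionSpaces.memLp_comp_smul_fun (Lp.memLp b) hρ').coeFn_toLp]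
      with x h1 h2
    rw [h1, h2]
  have e2 : lpDilation (V := ℝ) (F := ℂ) (p := (2 : ℝ≥0∞)) ρ hρ.ne' ENNReal.ofNat_ne_top (𝓕 b : Lp ℂ 2 (volume : Measure ℝ)) =
      (Literature.Analysis.FunctionSpaces.memLp_comp_smul_fun
        (Lp.memLp (𝓕 b : Lp ℂ 2 (volume : Measure ℝ))) (inv_ne_zero hρ')).toLp _ := by
    apply Lp.ext
    filter_upwards [lpDilation_coeFn (V := ℝ) (F := ℂ) (p := (2 : ℝ≥0∞)) hρ.ne' ENNReal.ofNat_ne_top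
      (𝓕 b : Lp ℂ 2 (volume : Measure ℝ)),
      (Literature.Analysis.FunctionSpaces.memLp_comp_smul_fun
        (Lp.memLp (𝓕 b : Lp ℂ 2 (volume : Measure ℝ))) (inv_ne_zero hρ')).coeFn_toLp] with x h1 h2
    rw [h1, h2, inv_inv]
  rw [e1, key, ← e2, Module.finrank_self, pow_one, inv_inv, abs_of_pos hρ,
    ← smul_comm ρ ((ρ : ℂ)⁻¹), ← smul_assoc, Complex.real_smul,
    mul_inv_cancel₀ (by exact_mod_cast hρ.ne' : (ρ : ℂ) ≠ 0), one_smul]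

/-- `⟪𝔽a, D_ρ 𝔽b⟫ = ρ⁻¹ ⟪a, D_{ρ⁻¹} b⟫` (Plancherel + the dilation law). [cite: ConnesConsani2021, Prop. 4.5 (iv) proof §4 p. 17] -/
private theorem inner_fourier_lpDilation_fourier (a b : Lp ℂ 2 (volume : Measure ℝ)) {ρ : ℝ}
    (hρ : 0 < ρ) :
    ⟪(𝓕 a : Lp ℂ 2 (volume : Measure ℝ)), lpDilation (V := ℝ) (F := ℂ) (p := (2 : ℝ≥0∞)) ρ hρ.ne' ENNReal.ofNat_ne_top (𝓕 b : Lp ℂ 2 (volume : Measure ℝ))⟫_ℂ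
      = (ρ⁻¹ : ℂ) * ⟪a, lpDilation (V := ℝ) (F := ℂ) (p := (2 : ℝ≥0∞)) (ρ⁻¹) ((inv_pos.2 hρ).ne') ENNReal.ofNat_ne_top b⟫_ℂ := by
  rw [lpDilation_fourier hρ, inner_smul_right, Lp.inner_fourier_eq]

/-- For a real-valued `u`, `⟪u, D_a u⟫` is real. [folklore] -/
private theorem conj_inner_lpDilation_self {u : Lp ℂ 2 (volume : Measure ℝ)}
    (hu : ∀ᵐ x : ℝ, conj ((u : ℝ → ℂ) x) = (u : ℝ → ℂ) x) {a : ℝ} (ha : a ≠ 0) :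
    conj ⟪u, lpDilation (V := ℝ) (F := ℂ) (p := (2 : ℝ≥0∞)) a ha ENNReal.ofNat_ne_top u⟫_ℂ = ⟪u, lpDilation (V := ℝ) (F := ℂ) (p := (2 : ℝ≥0∞)) a ha ENNReal.ofNat_ne_top u⟫_ℂ := by
  rw [MeasureTheory.L2.inner_def, ← integral_conj]
  refine integral_congr_ae ?_
  have hu' := Literature.Analysis.OperatorTheory.ae_eq_comp_smul (V := ℝ) hu ha
  filter_upwards [hu, hu',
    lpDilation_coeFn (V := ℝ) (F := ℂ) (p := (2 : ℝ≥0∞)) ha ENNReal.ofNat_ne_top u] with x hx hx' hD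
  simp only [smul_eq_mul] at hx' hD
  rw [hD, RCLike.inner_apply, map_mul, Complex.conj_conj, hx', hx]

/-- For a real-valued `u`: `⟪u, D_{ρ⁻¹} u⟫ = ρ ⟪u, D_ρ u⟫` (change of variables; `u` real).
[folklore] -/
private theorem inner_lpDilation_inv_self {u : Lp ℂ 2 (volume : Measure ℝ)}
    (hu : ∀ᵐ x : ℝ, conj ((u : ℝ → ℂ) x) = (u : ℝ → ℂ) x) {ρ : ℝ} (hρ : 0 < ρ) :
    ⟪u, lpDilation (V := ℝ) (F := ℂ) (p := (2 : ℝ≥0∞)) (ρ⁻¹) ((inv_pos.2 hρ).ne') ENNReal.ofNat_ne_top u⟫_ℂ = (ρ : ℂ) * ⟪u, lpDilation (V := ℝ) (F := ℂ) (p := (2 : ℝ≥0∞)) ρ hρ.ne' ENNReal.ofNat_ne_top u⟫_ℂ := by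
  have h := inner_lpDilation_left u u hρ.ne'
  have h2 : ⟪lpDilation (V := ℝ) (F := ℂ) (p := (2 : ℝ≥0∞)) ρ hρ.ne' ENNReal.ofNat_ne_top u, u⟫_ℂ = ⟪u, lpDilation (V := ℝ) (F := ℂ) (p := (2 : ℝ≥0∞)) ρ hρ.ne' ENNReal.ofNat_ne_top u⟫_ℂ := by
    rw [← inner_conj_symm, conj_inner_lpDilation_self hu]
  rw [h2, abs_of_pos hρ] at h
  rw [h, ← mul_assoc]
  push_cast
  rw [mul_inv_cancel₀ (by exact_mod_cast hρ.ne' : (ρ : ℂ) ≠ 0), one_mul]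

/-- **`⟨η_n|ϑ(ρ⁻¹)η_n⟩ = ⟨ξ_n|ϑ(ρ⁻¹)ξ_n⟩`**, at the level of `⟪·, D_ρ ·⟫`: "`𝔽 ∘ ϑ(ρ) = ϑ(ρ⁻¹) ∘ 𝔽`"
and "`⟨ξ|ϑ(ρ)ξ⟩ = ⟨ξ|ϑ(ρ⁻¹)ξ⟩` for `ξ` real and even". [cite: ConnesConsani2021, Prop. 4.5 (iv) proof §4 p. 17] -/
theorem inner_prolateEta_lpDilation (n : ℕ) {ρ : ℝ} (hρ : 0 < ρ) :
    ⟪prolateEta n, lpDilation (V := ℝ) (F := ℂ) (p := (2 : ℝ≥0∞)) ρ hρ.ne' ENNReal.ofNat_ne_top (prolateEta n)⟫_ℂ = ⟪prolateXi n, lpDilation (V := ℝ) (F := ℂ) (p := (2 : ℝ≥0∞)) ρ hρ.ne' ENNReal.ofNat_ne_top (prolateXi n)⟫_ℂ := by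
  have hu : ∀ᵐ x : ℝ, conj ((prolateXi n : ℝ → ℂ) x) = (prolateXi n : ℝ → ℂ) x := by
    filter_upwards [prolateXi_coeFn n] with x hx
    rw [hx]
    simp [prolateXiFun]
  rw [prolateEta, inner_fourier_lpDilation_fourier _ _ hρ, inner_lpDilation_inv_self hu hρ, ← mul_assoc,
    inv_mul_cancel₀ (by exact_mod_cast hρ.ne' : (ρ : ℂ) ≠ 0), one_mul]

/-- **`η_n = λ(n) ξ_n + √(1 − λ(n)²) ζ_n`** in `L²(ℝ)` ("`η_n` is a unit vector … with
`η_n = λ(n)ξ_n + √(1−λ(n)²)ζ_n`", proof of (iv)). [cite: ConnesConsani2021, Prop. 4.5 (iv) proof §4 p. 17] -/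
theorem prolateEta_eq_add (n : ℕ) :
    prolateEta n = (prolateEigen n : ℂ) • prolateXi n
      + ((Real.sqrt (1 - prolateEigen n ^ 2) : ℝ) : ℂ) • prolateZeta n := by
  have hc : Real.sqrt (1 - prolateEigen n ^ 2) ≠ 0 := by
    have h := abs_prolateEigen_lt_one n
    have : 0 < 1 - prolateEigen n ^ 2 := by
      nlinarith [abs_nonneg (prolateEigen n), sq_abs (prolateEigen n)]
    exact (Real.sqrt_pos.2 this).ne'
  rw [prolateZeta, smul_smul, ← Complex.ofReal_mul, mul_inv_cancel₀ hc, Complex.ofReal_one, one_smul,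
    prolatePsi_eq, add_sub_cancel]

/-- **Proposition 4.5 (iv), eq. (hattrick), DISCHARGED**:
`⟨ξ_n|ϑ(ρ⁻¹)ξ_n⟩ = ⟨ζ_n|ϑ(ρ⁻¹)ζ_n⟩ + τ(n)(⟨ξ_n|ϑ(ρ⁻¹)ζ_n⟩ + ⟨ζ_n|ϑ(ρ⁻¹)ξ_n⟩)` for `ρ > 0`.
[cite: ConnesConsani2021, Prop. 4.5 (iv) §4 p. 16 eq. (hattrick); proof p. 17] -/
theorem CC2021_prop_4_5_iv_holds : CC2021_prop_4_5_iv := by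
  intro n ρ hρ
  have hlt := abs_prolateEigen_lt_one n
  have hpos : 0 < 1 - prolateEigen n ^ 2 := by
    nlinarith [abs_nonneg (prolateEigen n), sq_abs (prolateEigen n)]
  set l : ℝ := prolateEigen n with hl
  set c : ℝ := Real.sqrt (1 - l ^ 2) with hc
  have hc2 : c ^ 2 = 1 - l ^ 2 := by rw [hc]; exact Real.sq_sqrt hpos.le
  have hcpos : 0 < c := Real.sqrt_pos.2 hpos
  have hcC : (c : ℂ) ≠ 0 := by exact_mod_cast hcpos.ne'
  have hc2C : (c : ℂ) ^ 2 = 1 - (l : ℂ) ^ 2 := by exact_mod_cast hc2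
  -- pass to `L²` classes and inner products against `D_ρ`
  rw [repCoeff_congr_ae (prolateXi_coeFn n).symm (prolateXi_coeFn n).symm,
    repCoeff_congr_ae (prolateZeta_coeFn n).symm (prolateZeta_coeFn n).symm,
    repCoeff_congr_ae (prolateXi_coeFn n).symm (prolateZeta_coeFn n).symm,
    repCoeff_congr_ae (prolateZeta_coeFn n).symm (prolateXi_coeFn n).symm,
    repCoeff_eq_inner_lpDilation _ _ hρ, repCoeff_eq_inner_lpDilation _ _ hρ,
    repCoeff_eq_inner_lpDilation _ _ hρ, repCoeff_eq_inner_lpDilation _ _ hρ]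
  set A := ⟪prolateXi n, lpDilation (V := ℝ) (F := ℂ) (p := (2 : ℝ≥0∞)) ρ hρ.ne' ENNReal.ofNat_ne_top (prolateXi n)⟫_ℂ with hA
  set B := ⟪prolateXi n, lpDilation (V := ℝ) (F := ℂ) (p := (2 : ℝ≥0∞)) ρ hρ.ne' ENNReal.ofNat_ne_top (prolateZeta n)⟫_ℂ with hB
  set C := ⟪prolateZeta n, lpDilation (V := ℝ) (F := ℂ) (p := (2 : ℝ≥0∞)) ρ hρ.ne' ENNReal.ofNat_ne_top (prolateXi n)⟫_ℂ with hC
  set D := ⟪prolateZeta n, lpDilation (V := ℝ) (F := ℂ) (p := (2 : ℝ≥0∞)) ρ hρ.ne' ENNReal.ofNat_ne_top (prolateZeta n)⟫_ℂ with hD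
  -- the identity `⟪η, D_ρ η⟫ = ⟪ξ, D_ρ ξ⟫` expanded
  have key := inner_prolateEta_lpDilation n hρ
  rw [prolateEta_eq_add n] at key
  simp only [map_add, map_smul, inner_add_left, inner_add_right, inner_smul_left, inner_smul_right,
    Complex.conj_ofReal] at key
  rw [← hl, ← hA, ← hB, ← hC, ← hD] at key
  have h3 : (c : ℂ) ^ 2 * A = l * c * (B + C) + c ^ 2 * D := by
    linear_combination (-1 : ℂ) * key + A * hc2C
  have key2 : (c : ℂ) * A = l * (B + C) + c * D :=
    mul_left_cancel₀ hcC (by linear_combination h3)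
  have htau : (prolateTau n : ℂ) = (l : ℂ) / (c : ℂ) := by
    rw [prolateTau, ← hl, ← hc, Complex.ofReal_div]
  rw [htau]
  field_simp
  linear_combination (Real.sqrt ρ : ℂ) * key2

end Hattrick

/-! ## Proposition 4.5 (iii), the operator inequality (smaller): `Σ λ(n)²|ζ_n⟩⟨ζ_n| ≤ P P̂ P`

Printed proof (p. 17): the planes `E_n = span{ξ_n, η_n}` are pairwise orthogonal and invariant under
`P, P̂`, and on `E_n` one has `P P̂ P = λ(n)²|ζ_n⟩⟨ζ_n|`.  Typed through Bessel's inequality for the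
orthonormal family `f_n = P̂ξ_n/√(1−λ(n)²) ∈ E_n` (`P̂ξ_n = ξ_n − λ(n)η_n`), for which
`⟨f_n, P̂Pξ⟩ = −λ(n)⟨ζ_n, ξ⟩`. -/

section Smaller

/-- `⟪T x, y⟫ = ⟪x, T y⟫` for a self-adjoint bounded operator. [folklore] -/
private theorem inner_map_comm_of_isSelfAdjoint {H : Type*} [NormedAddCommGroup H]
    [InnerProductSpace ℂ H] [CompleteSpace H] {T : H →L[ℂ] H} (hT : IsSelfAdjoint T) (x y : H) :
    ⟪T x, y⟫_ℂ = ⟪x, T y⟫_ℂ := by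
  rw [← ContinuousLinearMap.adjoint_inner_right T x y, hT.adjoint_eq]

/-- **`𝔽² = reflection` on `L²(ℝ)`**: `𝔽(𝔽f) = f(−·)` (Schwartz density and Fourier inversion).
[folklore] -/
private theorem fourierLp_fourierLp (f : Lp ℂ 2 (volume : Measure ℝ)) :
    (𝓕 (𝓕 f : Lp ℂ 2 (volume : Measure ℝ)) : Lp ℂ 2 (volume : Measure ℝ)) = lpDilation (V := ℝ) (F := ℂ) (p := (2 : ℝ≥0∞)) (-1) (by norm_num) ENNReal.ofNat_ne_top f := by
  refine DenseRange.induction_on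
    (p := fun f : Lp ℂ 2 (volume : Measure ℝ) ↦
      (𝓕 (𝓕 f : Lp ℂ 2 (volume : Measure ℝ)) : Lp ℂ 2 (volume : Measure ℝ)) = lpDilation (V := ℝ) (F := ℂ) (p := (2 : ℝ≥0∞)) (-1) (by norm_num) ENNReal.ofNat_ne_top f)
    (SchwartzMap.denseRange_toLpCLM (F := ℂ) (p := 2) (μ := (volume : Measure ℝ)) ENNReal.ofNat_ne_top)
    f ?_ ?_
  · exact isClosed_eq (by fun_prop) (lpDilation (V := ℝ) (F := ℂ) (p := (2 : ℝ≥0∞)) (-1) (by norm_num) ENNReal.ofNat_ne_top).continuous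
  · intro φ
    have hφ : ∀ y : ℝ, 𝓕 (𝓕 (φ : ℝ → ℂ)) y = φ (-y) := fun y ↦ by
      have h := Real.fourierInv_eq_fourier_neg (𝓕 (φ : ℝ → ℂ)) (-y)
      rw [neg_neg] at h
      rw [← h, φ.continuous.fourierInv_fourier_eq φ.integrable (𝓕 φ).integrable]
    rw [SchwartzMap.toLpCLM_apply, SchwartzMap.toLp_fourier_eq, SchwartzMap.toLp_fourier_eq]
    apply Lp.ext
    filter_upwards [(𝓕 (𝓕 φ)).coeFn_toLp 2 (volume : Measure ℝ),
      lpDilation_coeFn (V := ℝ) (F := ℂ) (p := (2 : ℝ≥0∞)) (show (-1 : ℝ) ≠ 0 by norm_num)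
        ENNReal.ofNat_ne_top (φ.toLp 2 (volume : Measure ℝ)),
      Literature.Analysis.OperatorTheory.ae_eq_comp_smul (V := ℝ)
        (φ.coeFn_toLp 2 (volume : Measure ℝ)) (show (-1 : ℝ) ≠ 0 by norm_num)] with x h1 h2 h3
    rw [h1, h2, h3, SchwartzMap.fourier_coe, SchwartzMap.fourier_coe, hφ, smul_eq_mul, neg_one_mul]

/-- `ξ_n(−·) = ξ_n` in `L²(ℝ)` (`ξ_n` is even). [cite: ConnesConsani2021, Prop. 4.5 (i) §4 p. 16] -/
theorem lpDilation_neg_one_prolateXi (n : ℕ) : lpDilation (V := ℝ) (F := ℂ) (p := (2 : ℝ≥0∞)) (-1) (by norm_num) ENNReal.ofNat_ne_top (prolateXi n) = prolateXi n := by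
  apply Lp.ext
  have h := mem_evenPart_iff.mp (prolateXi_mem_evenPart n)
  filter_upwards [lpDilation_coeFn (V := ℝ) (F := ℂ) (p := (2 : ℝ≥0∞)) (show (-1 : ℝ) ≠ 0 by norm_num)
    ENNReal.ofNat_ne_top (prolateXi n), h] with x h1 h2
  rw [h1, smul_eq_mul, neg_one_mul, h2]

/-- **`𝔽 η_n = ξ_n`** (`𝔽² =` reflection and `ξ_n` even): the plane `E_n = span{ξ_n, η_n}` is
`𝔽`-invariant. [cite: ConnesConsani2021, Prop. 4.5 (iii) proof §4 p. 17] -/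
theorem fourier_prolateEta (n : ℕ) :
    (𝓕 (prolateEta n) : Lp ℂ 2 (volume : Measure ℝ)) = prolateXi n := by
  rw [prolateEta, fourierLp_fourierLp, lpDilation_neg_one_prolateXi]

/-- **`𝔽⁻¹ ξ_n = η_n`**. [cite: ConnesConsani2021, Prop. 4.5 (iii) proof §4 p. 17] -/
theorem fourierInv_prolateXi (n : ℕ) :
    (𝓕⁻ (prolateXi n) : Lp ℂ 2 (volume : Measure ℝ)) = prolateEta n := by
  rw [← fourier_prolateEta n, FourierTransform.fourierInv_fourier_eq]

/-- **`𝒫̂₁ ξ_n = λ(n) η_n`** ((chirem0.5) conjugated by `𝔽`). [cite: ConnesConsani2021, Prop. 4.5 (iii) proof §4 p. 17; §4 p. 16 eq. (cosalphan1)] -/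
theorem cutoffProjHat_prolateXi (n : ℕ) :
    cutoffProjHat 1 (prolateXi n) = (prolateEigen n : ℂ) • prolateEta n := by
  rw [cutoffProjHat_apply, show (𝓕 (prolateXi n) : Lp ℂ 2 (volume : Measure ℝ)) = prolateEta n from rfl,
    CC2021_prop_4_5_i_holds n, FourierTransform.fourierInv_smul, fourierInv_prolateXi]

/-- **`𝒫̂₁ η_n = η_n`** (`η_n = 𝔽ξ_n` with `ξ_n` supported in `[−1,1]`). [cite: ConnesConsani2021, Prop. 4.5 (iii) proof §4 p. 17] -/
theorem cutoffProjHat_prolateEta (n : ℕ) : cutoffProjHat 1 (prolateEta n) = prolateEta n := by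
  rw [cutoffProjHat_apply, fourier_prolateEta, cutoffProj_prolateXi, fourierInv_prolateXi]

/-- `(cosalphan1)`: `𝒫₁𝒫̂₁𝒫₁ξ_n = λ(n)² ξ_n`. [cite: ConnesConsani2021, §4 p. 16 eq. (cosalphan1)] -/
theorem cutoffProj_cutoffProjHat_prolateXi (n : ℕ) :
    cutoffProj 1 (cutoffProjHat 1 (cutoffProj 1 (prolateXi n))) = ((prolateEigen n : ℂ) ^ 2) • prolateXi n := by
  rw [cutoffProj_prolateXi, cutoffProjHat_prolateXi, map_smul, CC2021_prop_4_5_i_holds n, smul_smul, sq]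

/-- `P̂ ξ_n = ξ_n − λ(n) η_n`. [cite: ConnesConsani2021, Prop. 4.5 (iii) proof §4 p. 17] -/
theorem outerProjHat_prolateXi (n : ℕ) :
    outerProjHat (prolateXi n) = prolateXi n - (prolateEigen n : ℂ) • prolateEta n := by
  rw [outerProjHat_apply, cutoffProjHat_prolateXi]

/-- `P̂ η_n = 0`. [cite: ConnesConsani2021, Prop. 4.5 (iii) proof §4 p. 17] -/
theorem outerProjHat_prolateEta (n : ℕ) : outerProjHat (prolateEta n) = 0 := by
  rw [outerProjHat_apply, cutoffProjHat_prolateEta, sub_self]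

/-- `ψ_n = √(1 − λ(n)²) ζ_n`. [cite: ConnesConsani2021, Prop. 4.5 (iii) §4 p. 16] -/
theorem prolatePsi_eq_smul_prolateZeta (n : ℕ) :
    prolatePsi n = ((Real.sqrt (1 - prolateEigen n ^ 2) : ℝ) : ℂ) • prolateZeta n := by
  have hc : Real.sqrt (1 - prolateEigen n ^ 2) ≠ 0 := by
    have h := abs_prolateEigen_lt_one n
    exact (Real.sqrt_pos.2 (by nlinarith [abs_nonneg (prolateEigen n), sq_abs (prolateEigen n)])).ne'
  rw [prolateZeta, smul_smul, ← Complex.ofReal_mul, mul_inv_cancel₀ hc, Complex.ofReal_one, one_smul]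

/-- The Gram matrix of the `P̂ξ_n`: `⟪P̂ξ_n, P̂ξ_m⟫ = δ_{nm}(1 − λ(n)²)` (the planes `E_n` are pairwise
orthogonal). [cite: ConnesConsani2021, Prop. 4.5 (iii) proof §4 p. 17] -/
theorem inner_outerProjHat_prolateXi (n m : ℕ) :
    ⟪outerProjHat (prolateXi n), outerProjHat (prolateXi m)⟫_ℂ =
      if n = m then (((1 - prolateEigen n ^ 2 : ℝ)) : ℂ) else 0 := by
  have h1 := inner_prolateXi_eq_ite n m
  have h2 : ⟪prolateXi n, prolateEta m⟫_ℂ = (prolateEigen m : ℂ) * ⟪prolateXi n, prolateXi m⟫_ℂ := by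
    rw [← inner_conj_symm, inner_prolateEta_prolateXi m n, map_mul, Complex.conj_ofReal, inner_conj_symm]
  have h3 := inner_prolateEta_prolateXi n m
  have h4 := inner_prolateEta n m
  rw [outerProjHat_prolateXi, outerProjHat_prolateXi]
  simp only [inner_sub_left, inner_sub_right, inner_smul_left, inner_smul_right, Complex.conj_ofReal]
  rw [h2, h3, h4, h1]
  split_ifs with h
  · subst h
    push_cast
    ring
  · simp

/-- `⟪P̂ξ_n, P̂Pξ⟫ = −λ(n)√(1−λ(n)²)⟪ζ_n, ξ⟫` (`P̂² = P̂`, `Pξ_n = 0`, `Pη_n = ψ_n = √(1−λ(n)²)ζ_n`).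
[cite: ConnesConsani2021, Prop. 4.5 (iii) proof §4 p. 17] -/
theorem inner_outerProjHat_prolateXi_apply (n : ℕ) (ξ : Lp ℂ 2 (volume : Measure ℝ)) :
    ⟪outerProjHat (prolateXi n), outerProjHat (outerProj ξ)⟫_ℂ =
      -((prolateEigen n : ℂ) * ((Real.sqrt (1 - prolateEigen n ^ 2) : ℝ) : ℂ)) * ⟪prolateZeta n, ξ⟫_ℂ := by
  have hPh : IsStarProjection outerProjHat := (isStarProjection_cutoffProjHat 1).one_sub
  have hP : IsStarProjection outerProj := (isStarProjection_cutoffProj 1).one_sub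
  have hidem : outerProjHat (outerProjHat (prolateXi n)) = outerProjHat (prolateXi n) := by
    have := congrArg (fun T : Lp ℂ 2 (volume : Measure ℝ) →L[ℂ] Lp ℂ 2 (volume : Measure ℝ) ↦
      T (prolateXi n)) hPh.isIdempotentElem.eq
    simpa [mul_apply_eq_comp] using this
  rw [← inner_map_comm_of_isSelfAdjoint hPh.isSelfAdjoint, hidem, outerProjHat_prolateXi,
    inner_sub_left, inner_smul_left, Complex.conj_ofReal,
    ← inner_map_comm_of_isSelfAdjoint hP.isSelfAdjoint,
    ← inner_map_comm_of_isSelfAdjoint hP.isSelfAdjoint, outerProj_prolateXi, inner_zero_left,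
    show outerProj (prolateEta n) = prolatePsi n from rfl, prolatePsi_eq_smul_prolateZeta, inner_smul_left,
    Complex.conj_ofReal]
  ring

/-- **Proposition 4.5 (iii) DISCHARGED**: the `ψ_n` are real valued, pairwise orthogonal,
`‖ψ_n‖ = √(1−λ(n)²)`, and (smaller) `Σ_{n∈s} λ(n)²|⟨ζ_n, ξ⟩|² ≤ ‖P̂Pξ‖²` (Bessel's inequality for the
orthonormal family `P̂ξ_n/√(1−λ(n)²)`). [cite: ConnesConsani2021, Prop. 4.5 (iii) §4 p. 16 eq. (smaller); proof p. 17] -/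
theorem CC2021_prop_4_5_iii_holds : CC2021_prop_4_5_iii := by
  refine ⟨conj_prolatePsiFun, fun n m h ↦ inner_prolatePsi_eq_zero h, norm_prolatePsi, ?_⟩
  intro ξ _ s
  have hpos : ∀ n : ℕ, 0 < 1 - prolateEigen n ^ 2 := fun n ↦ by
    have h := abs_prolateEigen_lt_one n
    nlinarith [abs_nonneg (prolateEigen n), sq_abs (prolateEigen n)]
  have hc : ∀ n : ℕ, Real.sqrt (1 - prolateEigen n ^ 2) ≠ 0 := fun n ↦ (Real.sqrt_pos.2 (hpos n)).ne'
  have hc2 : ∀ n : ℕ, Real.sqrt (1 - prolateEigen n ^ 2) ^ 2 = 1 - prolateEigen n ^ 2 := fun n ↦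
    Real.sq_sqrt (hpos n).le
  set f : ℕ → Lp ℂ 2 (volume : Measure ℝ) := fun n ↦
    (((Real.sqrt (1 - prolateEigen n ^ 2))⁻¹ : ℝ) : ℂ) • outerProjHat (prolateXi n) with hf
  have hon : Orthonormal ℂ f := by
    rw [orthonormal_iff_ite]
    intro n m
    simp only [hf]
    rw [inner_smul_left, inner_smul_right, inner_outerProjHat_prolateXi, Complex.conj_ofReal]
    split_ifs with h
    · subst h
      have hcC : ((Real.sqrt (1 - prolateEigen n ^ 2) : ℝ) : ℂ) ≠ 0 := by exact_mod_cast hc n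
      rw [show (((1 - prolateEigen n ^ 2 : ℝ)) : ℂ) = ((Real.sqrt (1 - prolateEigen n ^ 2) : ℝ) : ℂ) ^ 2 by
        rw [← Complex.ofReal_pow, hc2 n]]
      push_cast
      field_simp
    · simp
  have hterm : ∀ n : ℕ, ‖⟪f n, outerProjHat (outerProj ξ)⟫_ℂ‖ ^ 2 =
      prolateEigen n ^ 2 * ‖⟪prolateZeta n, ξ⟫_ℂ‖ ^ 2 := by
    intro n
    have hv : ⟪f n, outerProjHat (outerProj ξ)⟫_ℂ = -(prolateEigen n : ℂ) * ⟪prolateZeta n, ξ⟫_ℂ := by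
      simp only [hf]
      rw [inner_smul_left, inner_outerProjHat_prolateXi_apply, Complex.conj_ofReal]
      have : ((Real.sqrt (1 - prolateEigen n ^ 2) : ℝ) : ℂ) ≠ 0 := by exact_mod_cast hc n
      push_cast
      field_simp
    rw [hv, norm_mul, norm_neg, Complex.norm_real, Real.norm_eq_abs, mul_pow, sq_abs]
  calc ∑ n ∈ s, prolateEigen n ^ 2 * ‖⟪prolateZeta n, ξ⟫_ℂ‖ ^ 2
      = ∑ n ∈ s, ‖⟪f n, outerProjHat (outerProj ξ)⟫_ℂ‖ ^ 2 :=
        Finset.sum_congr rfl fun n _ ↦ (hterm n).symm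
    _ ≤ ‖outerProjHat (outerProj ξ)‖ ^ 2 := hon.sum_inner_products_le _

end Smaller

/-! ## Lemma 4.2 (i): for an irreducible pair the angle operator is a scalar

Printed argument ("irreducible representations of `ℤ/2 ∗ ℤ/2` are parameterized by an angle"): the
self-adjoint operator `(P₁ − P₂)²` commutes with `P₁` and `P₂` (Kato), so each of its spectral subspaces
reduces the pair; irreducibility forces its spectrum to be a single point `{t}`, whence `|P₁ − P₂| = √t`
and `α = arcsin √t`.  The spectral subspace is produced by the continuous functional calculus with two
bump functions separated at the midpoint of two putative spectral values. -/

section IrreduciblePair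

variable {H : Type*} [NormedAddCommGroup H] [InnerProductSpace ℂ H] [CompleteSpace H]

/-- Two distinct spectral values of a self-adjoint `T` commuting with `P₁, P₂` give a nontrivial closed
subspace invariant under `P₁, P₂` (the kernel of a bump function of `T`). [folklore] -/
private theorem false_of_two_mem_spectrum [Nontrivial (H →L[ℂ] H)] {P₁ P₂ T : H →L[ℂ] H}
    (hT : IsSelfAdjoint T) (hc1 : Commute T P₁) (hc2 : Commute T P₂)
    (hK : ∀ K : Submodule ℂ H, IsClosed (K : Set H) →
      (∀ x ∈ K, P₁ x ∈ K) → (∀ x ∈ K, P₂ x ∈ K) → (K = ⊥ ∨ K = ⊤))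
    {s t : ℝ} (hs : s ∈ spectrum ℝ T) (ht : t ∈ spectrum ℝ T) (hlt : s < t) : False := by
  set m : ℝ := (s + t) / 2 with hm
  set f : ℝ → ℝ := fun x ↦ max (m - x) 0 with hf_def
  set g : ℝ → ℝ := fun x ↦ max (x - m) 0 with hg_def
  have hf : Continuous f := by rw [hf_def]; fun_prop
  have hg : Continuous g := by rw [hg_def]; fun_prop
  have hfg : (fun x ↦ f x * g x) = fun _ ↦ (0 : ℝ) := by
    funext x
    simp only [hf_def, hg_def]
    rcases le_total x m with h | h
    · rw [max_eq_right (by linarith : x - m ≤ 0), mul_zero]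
    · rw [max_eq_right (by linarith : m - x ≤ 0), zero_mul]
  have hFG : cfc f T * cfc g T = 0 := by
    rw [← cfc_mul f g T hf.continuousOn hg.continuousOn, hfg, cfc_const_zero]
  have hne : ∀ (k : ℝ → ℝ), Continuous k → ∀ r ∈ spectrum ℝ T, k r ≠ 0 → cfc k T ≠ 0 := by
    intro k hk r hr hkr h0
    have hspec := cfc_map_spectrum k T hT hk.continuousOn
    rw [h0, spectrum.zero_eq] at hspec
    have : k r ∈ k '' spectrum ℝ T := Set.mem_image_of_mem k hr
    rw [← hspec, Set.mem_singleton_iff] at this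
    exact hkr this
  have hFne : cfc f T ≠ 0 := hne f hf s hs (by
    have : f s = m - s := max_eq_left (by rw [hm]; linarith)
    rw [this, hm]; linarith)
  have hGne : cfc g T ≠ 0 := hne g hg t ht (by
    have : g t = t - m := max_eq_left (by rw [hm]; linarith)
    rw [this, hm]; linarith)
  -- the invariant subspace `K = ker f(T)`
  set K : Submodule ℂ H := LinearMap.ker (cfc f T).toLinearMap with hKdef
  have hKc : IsClosed (K : Set H) := (cfc f T).isClosed_ker
  have hinv : ∀ P : H →L[ℂ] H, Commute (cfc f T) P → ∀ x ∈ K, P x ∈ K := by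
    intro P hP x hx
    rw [hKdef, LinearMap.mem_ker] at hx ⊢
    have := congrArg (fun S : H →L[ℂ] H ↦ S x) hP.eq
    simp only [mul_apply_eq_comp] at this
    change (cfc f T) (P x) = 0
    rw [this, show (cfc f T) x = 0 from hx, map_zero]
  rcases hK K hKc (hinv P₁ (hc1.cfc_real f)) (hinv P₂ (hc2.cfc_real f)) with hbot | htop
  · obtain ⟨y, hy⟩ : ∃ y, cfc g T y ≠ 0 := by
      by_contra h
      push Not at h
      exact hGne (ContinuousLinearMap.ext fun y ↦ by rw [h y]; rfl)
    have hmem : cfc g T y ∈ K := by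
      rw [hKdef, LinearMap.mem_ker]
      have := congrArg (fun S : H →L[ℂ] H ↦ S y) hFG
      simpa [mul_apply_eq_comp] using this
    rw [hbot, Submodule.mem_bot] at hmem
    exact hy hmem
  · apply hFne
    ext x
    have hx : x ∈ K := by rw [htop]; exact Submodule.mem_top
    rw [hKdef, LinearMap.mem_ker] at hx
    exact hx

/-- **Lemma 4.2 (i), second sentence, DISCHARGED**: for an irreducible pair of orthogonal projections
the angle operator `∡(P₁, P₂)` is a scalar `α ∈ [0, π/2]`. [cite: ConnesConsani2021, Lemma 4.2 (i) §4 p. 15 (arXiv item Lemma 22); ConnesMarcolli2008, Ch. 2 §3.3 Lemma 2.3] -/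
theorem CC2021_lem_4_2_i_holds : CC2021_lem_4_2_i := by
  intro H _ _ _ P₁ P₂ h₁ h₂ hirr
  obtain ⟨hnt, hK⟩ := hirr
  haveI : Nontrivial (H →L[ℂ] H) := by
    obtain ⟨x, hx⟩ := exists_ne (0 : H)
    exact ⟨⟨1, 0, fun h ↦ hx (by simpa using congrArg (fun T : H →L[ℂ] H ↦ T x) h)⟩⟩
  set a : H →L[ℂ] H := P₁ - P₂ with ha_def
  have ha : IsSelfAdjoint a := h₁.isSelfAdjoint.sub h₂.isSelfAdjoint
  have hT : IsSelfAdjoint (a ^ 2) := ha.pow 2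
  have hP1 : P₁ * P₁ = P₁ := h₁.isIdempotentElem.eq
  have hP2 : P₂ * P₂ = P₂ := h₂.isIdempotentElem.eq
  have hc1 : Commute (a ^ 2) P₁ := by
    rw [sq]; exact (PairOfProjections.commute_left_sq_sub hP1 hP2).symm
  have hc2 : Commute (a ^ 2) P₂ := by
    rw [sq]; exact (PairOfProjections.commute_right_sq_sub hP1 hP2).symm
  -- the spectrum of `(P₁ − P₂)²` is a single point `t₀`
  have hsub : (spectrum ℝ (a ^ 2)).Subsingleton := fun s hs t ht ↦ by
    by_contra hst
    rcases lt_or_gt_of_ne hst with h | h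
    · exact false_of_two_mem_spectrum hT hc1 hc2 hK hs ht h
    · exact false_of_two_mem_spectrum hT hc1 hc2 hK ht hs h
  obtain ⟨t₀, ht₀⟩ := ContinuousFunctionalCalculus.spectrum_nonempty (R := ℝ) (a ^ 2) hT
  have hspecT : spectrum ℝ (a ^ 2) = {t₀} := hsub.eq_singleton_of_mem ht₀
  have hsq : ∀ x ∈ spectrum ℝ a, x ^ 2 = t₀ := by
    intro x hx
    have h := cfc_map_spectrum (fun y : ℝ ↦ y ^ 2) a ha
    rw [cfc_pow_id a 2 ha, hspecT] at h
    have : x ^ 2 ∈ (fun y : ℝ ↦ y ^ 2) '' spectrum ℝ a := Set.mem_image_of_mem _ hx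
    rw [← h, Set.mem_singleton_iff] at this
    exact this
  refine ⟨Real.arcsin (Real.sqrt t₀),
    ⟨Real.arcsin_nonneg.2 (Real.sqrt_nonneg _), Real.arcsin_le_pi_div_two _⟩, ?_⟩
  have heq : (spectrum ℝ a).EqOn (fun x : ℝ ↦ Real.arcsin |x|) (fun _ ↦ Real.arcsin (Real.sqrt t₀)) := by
    intro x hx
    simp only
    rw [← hsq x hx, Real.sqrt_sq_eq_abs]
  rw [angleOp, ← ha_def, cfc_congr heq, cfc_const (Real.arcsin (Real.sqrt t₀)) a ha,
    Algebra.algebraMap_eq_smul_one, ← algebraMap_smul ℂ (Real.arcsin (Real.sqrt t₀)) (1 : H →L[ℂ] H)]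
  rfl

end IrreduciblePair

end Discharges

end Literature.NumberTheory.ConnesConsani2021

end
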